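import Literature.AlgebraicGeometry.Motives.HodgeThetaSubalgebraUnitary
import Literature.AlgebraicGeometry.Motives.HodgeLieWeightOneRankFourCenter
import HarnessLib

/-!
# A rational Lie subalgebra of `𝔲_E(V, ψ)` whose complexification contains `Θ` is all of `𝔲_E(V, ψ)` when `E` is a quartic CM field acting with multiplicities `{(1,1), (2,0)}` (Moonen–Zarhin 1999 Thm. (0.2)(4), simple Type IV(2,1), Lie step)

Family `hodge`, layer `Literature/AlgebraicGeometry/Motives` (abstract polarizable `ℚ`-Hodge structures; no
geometry). Research context: cell `pub-hodge-ring2` (HONEST FRAMING: research route conditional on HC_CM; not a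
corollary; Q11.4-sentence-2 already refuted in dim ≥ 3), Literature lane, programme R10 "type IV(2,1) fourfolds",
abstract half. This file is UNCONDITIONAL Hodge–Lie linear algebra and no step towards a summit statement. It is
the quartic companion of the imaginary-quadratic file `Motives/HodgeThetaSubalgebraUnitary` (`UnitaryTheta.*`,
Ribet type `(m, 1)`), whose grading, line-orbit and `spanC` vocabulary it reuses by name.

SETTING. `H` an effective polarizable `ℚ`-Hodge structure of weight `1` on `V`, `dim_ℚ V = 8`, with polarization
`ψ`; `φ ∈ E = End_Hdg(V)` with `E = ℚ + ℚφ + ℚφ² + ℚφ³` a FIELD (every non-zero element of `E` has a left inverse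
in `End_ℚ(V)`), and two eigenvalues `μ₁, μ₂` of `φ_ℂ` with `μ₁, conj μ₁, μ₂, conj μ₂` pairwise distinct (the four
complex embeddings of the quartic CM field `E = ℚ(φ)`; Deligne LNM 900 §4: `H¹ ⊗ ℂ = ⊕_σ H¹_σ`). Write
`W_c = ker(φ_ℂ - c)`. The MULTIPLICITY HYPOTHESIS is `dim(W_{μ₁} ∩ V^{1,0}) = dim(W_{μ₁} ∩ V^{0,1}) = 1`,
`dim(W_{μ₂} ∩ V^{1,0}) = 2`: the CM field `E` acts on `V^{1,0}` with multiplicities `(n_σ) = (1, 1, 2, 0)`, i.e.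
the signature of the `E`-hermitian form is `{(1,1), (2,0)}`. This is Moonen–Zarhin's simple Type IV(2,1) in
dimension `4` OUTSIDE their case (b) (an imaginary quadratic subfield acting with multiplicities `(2,2)` can only
occur for signature `{(1,1),(1,1)}`), for which Thm. (0.2)(4) gives `Hg(X) = Sp_E(V, φ) = U_E(V, ψ)` and
`B(Xⁿ) = D(Xⁿ)` for all `n` ("(2.4) g = 4 … in op. cit. [MZ95] we already proved Theorem (0.2) for simple abelian
fourfolds").

Write `𝔨 = 𝔲_E(V, ψ) = {X ∈ End_ℚ(V) : Xφ = φX, ψ(Xv, w) + ψ(v, Xw) = 0}`; its complexification is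
`𝔨_ℂ ≅ 𝔤𝔩(W_{μ₁}) × 𝔤𝔩(W_{μ₂})` (restriction; `W_{conj c}` is `ψ_ℂ`-dual to `W_c`).

PROVED HERE (no definition, no named fact, D-0026). Let `𝔤 ⊆ 𝔨` be ANY `ℚ`-subspace closed under the commutator,
commuting with `E`, `ψ`-skew, whose complex span `𝔤_ℂ = spanC 𝔤` contains a Hodge operator `Θ` (`= 2p - 1` on
`V^{p,1-p}`). Then

* `QuarticTheta.mem_spanC_of_commute_of_skew` — `𝔤_ℂ = 𝔨_ℂ`; `QuarticTheta.mem_spanC_iff_commute_and_skew`;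
  `QuarticTheta.mem_iff_commute_and_skew` (`𝔤 = 𝔨` by descent).
* `QuarticTheta.mem_hodgeLie_iff_commute_and_skew` — **`Lie Hg(H) = 𝔲_E(V, ψ)`** (`Hg = Sp_E(V, φ)`, MZ99 (0.2)(4)),
  infinitesimally (`[HodgeTensorFacts]`); `QuarticTheta.eq_hodgeLie` (Deligne's minimality in Lie form).
* `QuarticTheta.wordDerAt_eq_zero_of_commute_of_skew` — **Theorem L″**: a rational coefficient tensor killed slice
  by slice by the matrix of `Θ` is killed by the matrix of every `Y ∈ 𝔨_ℂ` (annihilator Lie algebra `annLie`,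
  Deligne LNM 900 I §3) — the Lie step of `B(Xⁿ) = D(Xⁿ)`.

PROOF (the argument of `HodgeThetaSubalgebraUnitary`, run on two eigenspaces; section numbers of this file). §2:
`E` acts on each `W_c` by
scalars; the Rosati involution is complex conjugation on `E` (second Hodge–Riemann relation on a pure-type vector of
`W_{conj c}`), so `ψ_ℂ(W_a, W_b) = 0` unless `b = conj a`; `dim W_c = 2` for the four `c`, `V_ℂ = ⊕_c W_c`,
`W_{μ₂} ⊆ V^{1,0}` (dimension count); an element of `𝔨_ℂ` vanishing on `W_{μ₁} ⊕ W_{μ₂}` vanishes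
(`eq_zero_of_forall_eigenspace`). §3: a `𝔤`-stable `U ≤ W_c` is `0` or `W_c` (`U† ⊕ U = W_c` by Hodge–Riemann, the
projector commutes with `𝔤`, hence lies in `E_ℂ`, hence is a scalar on `W_c`). §4: on `W_{μ₁} = ℂe ⊕ ℂℓ` the
line-orbit lemma (`UnitaryTheta.exists_raising` for `Θ` and `-Θ`) gives `E₊ : ℓ ↦ e`, `E₋ : e ↦ ℓ` in `𝔤_ℂ`,
vanishing on `W_{μ₂} ⊆ V^{1,0}`; `H₁ = [E₊, E₋]` and `ζ = Θ - H₁ ∈ 𝔤_ℂ` is `0` on `W_{μ₁}` and `1` on `W_{μ₂}`;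
`ζ` commutes with `𝔤` (checked on `W_{μ₁} ⊕ W_{μ₂}`), so `ζ ∈ E_ℂ ∩ 𝔤_ℂ = (E ∩ 𝔤)_ℂ` (rational coordinates,
`ratCoord`) and there is a RATIONAL `0 ≠ t ∈ 𝔤 ∩ E`; as `E` is a field, `t` acts on `W_{μ₁}` by a NON-ZERO scalar
(this replaces, for the centre of `Hg`, the Galois transitivity on the embeddings of `E`), whence
`I₁ ∈ 𝔤_ℂ` equal to `1` on `W_{μ₁}` and `0` on `W_{μ₂}`, and `𝔤_ℂ|_{W_{μ₁} ⊕ W_{μ₂}} ⊇ 𝔤𝔩(W_{μ₁}) × 0`. On the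
plane `W_{μ₂}` the restrictions of `𝔤_ℂ` form a bracket-closed space containing `1 = ζ|` without stable line
(§3), hence all of `𝔤𝔩(W_{μ₂})` (§1, `eq_top_of_forall_stable`: Lie's theorem for `𝔤𝔩₂` by hand — a
two-dimensional traceless subalgebra has `[X,Y]` nilpotent by `tr([X,Y]²) = 0` and Cayley–Hamilton). Determination
by `W_{μ₁} ⊕ W_{μ₂}` concludes.

## References

* [MoonenZarhin1999LowDim] B. Moonen, Yu. Zarhin, *Hodge classes on abelian varieties of low dimension*, Math.
  Ann. 315 (1999) 711–733 = arXiv:math/9901113 (held `paper:arxiv-math_9901113`), Introduction cases (a)–(d) and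
  Thm. (0.2)(4) (p. 1 of the arXiv text), §2 (2.4) "g = 4" and remark (2) (p. 5).
* [MoonenZarhin1995Duke] B. Moonen, Yu. Zarhin, *Hodge classes and Tate classes on simple abelian fourfolds*, Duke
  Math. J. 77 (1995) 553–581 (not held; the proof of Thm. (0.2) for simple fourfolds, quoted from MZ99 (2.4)).
* [Deligne1982HodgeCycles] P. Deligne, *Hodge cycles on abelian varieties*, LNM 900 (1982), I §3 (proof of
  Prop. 3.4), §4 (decomposition `H¹ ⊗ ℂ = ⊕_σ H¹_σ`, p. 30).
* [Gordon1997] B. B. Gordon, *A survey of the Hodge conjecture for abelian varieties*, arXiv:alg-geom/9709030, §6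
  (proof of Thm. 6.3.3, pp. 18–19: the method `MT(A, ℂ) → GL(W')`).
* [Ribet1983] K. A. Ribet, *Hodge classes on certain types of abelian varieties*, Amer. J. Math. 105 (1983), Thm. 3.
* [MumfordAV1970] D. Mumford, *Abelian Varieties* (1970), §21 (positivity of the Rosati involution).
* [Zarhin1983HodgeGroupsK3] Yu. G. Zarhin, *Hodge groups of K3 surfaces*, J. reine angew. Math. 341 (1983), §2.
* [VoisinHodgeI2002] C. Voisin, *Hodge Theory and Complex Algebraic Geometry I*, §7.1.2 Def. 7.7.
* [Huybrechts2016K3] D. Huybrechts, *Lectures on K3 Surfaces* (CUP 2016), §3.3.5, Lemma 3.3.12, Thm. 3.3.9.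
* [GoodmanWallachGTM255] R. Goodman, N. Wallach, *Symmetry, Representations, and Invariants*, GTM 255, §4.1.1.
* [Humphreys1972] J. E. Humphreys, *Introduction to Lie Algebras and Representation Theory*, GTM 9 (1972), §4.1
  Theorem and Cor. A (Lie's theorem; held `book:humphreys1972-introduction-lie-algebras-representation-theory`,
  p0029–p0031).
-/

noncomputable section

open scoped TensorProduct

namespace Literature.AlgebraicGeometry.Motives

namespace HodgeStructure

/-! ### §1 Two-dimensional linear algebra: a Lie algebra of operators on a plane containing `1` without stable line is everything -/

section GL2

variable {W : Type*} [AddCommGroup W] [Module ℂ W] [FiniteDimensional ℂ W]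

/-- **Cayley–Hamilton on a plane**: a traceless operator `C` of a two-dimensional space with `tr(C²) = 0`
squares to zero (`C² = tr(C) C - det(C)` and `tr(C²) = tr(C)² - 2 det C`), computed on the `2 × 2` matrix of `C`.
[folklore] -/
private theorem QuarticTheta.mul_self_eq_zero_of_trace_eq_zero (hW : Module.finrank ℂ W = 2) {C : Module.End ℂ W}
    (h1 : LinearMap.trace ℂ W C = 0) (h2 : LinearMap.trace ℂ W (C * C) = 0) : C * C = 0 := by
  classical
  set b := Module.finBasisOfFinrankEq ℂ W hW with hb
  rw [LinearMap.trace_eq_matrix_trace ℂ b, Matrix.trace_fin_two] at h1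
  rw [LinearMap.trace_eq_matrix_trace ℂ b, LinearMap.toMatrix_mul, Matrix.trace_fin_two,
    Matrix.mul_apply, Matrix.mul_apply, Fin.sum_univ_two, Fin.sum_univ_two] at h2
  rw [← (LinearMap.toMatrix b b).map_eq_zero_iff, LinearMap.toMatrix_mul]
  set M := LinearMap.toMatrix b b C with hM
  ext i j
  rw [Matrix.mul_apply, Fin.sum_univ_two, Matrix.zero_apply]
  fin_cases i <;> fin_cases j <;> simp only [Fin.isValue, Fin.zero_eta, Fin.mk_one]
  · linear_combination (2⁻¹ : ℂ) * h2 + ((2⁻¹ : ℂ) * (M 0 0 - M 1 1)) * h1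
  · linear_combination M 0 1 * h1
  · linear_combination M 1 0 * h1
  · linear_combination (2⁻¹ : ℂ) * h2 + ((2⁻¹ : ℂ) * (M 1 1 - M 0 0)) * h1

/-- **An irreducible Lie algebra of operators on a plane containing the scalars is everything** (Lie's theorem
for `𝔤𝔩₂`, by hand). Let `𝔩 ⊆ End(W)`, `dim W = 2`, be a `ℂ`-subspace closed under the commutator with `1 ∈ 𝔩`
and no `𝔩`-stable subspace other than `0, W`. Then `𝔩 = End(W)`: the traceless part `𝔩₀ = 𝔩 ∩ ker tr` is not
`0` (a line would be stable), not a line `ℂX` (an eigenspace of `X` would be stable, forcing `X` scalar and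
traceless, `X = 0`), and not a plane `ℂX + ℂY` (then `C = [X, Y] = aX + bY`; if `C = 0` an eigenspace of `X` is
stable; if `C ≠ 0` then `tr(CX) = tr(CY) = 0` gives `tr(C²) = 0`, so `C² = 0` and the line `ker C` is stable under
`X, Y` as `[X, C] = bC`, `[Y, C] = -aC`), hence `dim 𝔩₀ ≥ 3 = dim ker tr` and `𝔩 = ℂ·1 ⊕ ker tr`.
[cite: Humphreys1972, §4.1 Theorem and Cor. A (Lie's theorem)] -/
theorem QuarticTheta.eq_top_of_forall_stable (hW : Module.finrank ℂ W = 2)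
    (𝔩 : Submodule ℂ (Module.End ℂ W)) (hbr : ∀ X ∈ 𝔩, ∀ Y ∈ 𝔩, X * Y - Y * X ∈ 𝔩)
    (h1 : (1 : Module.End ℂ W) ∈ 𝔩)
    (hirr : ∀ U : Submodule ℂ W, (∀ X ∈ 𝔩, ∀ u ∈ U, X u ∈ U) → U = ⊥ ∨ U = ⊤) : 𝔩 = ⊤ := by
  classical
  haveI : Nontrivial W := Module.nontrivial_of_finrank_pos (R := ℂ) (by rw [hW]; exact two_pos)
  set tr := LinearMap.trace ℂ W with htr
  set 𝔩₀ : Submodule ℂ (Module.End ℂ W) := 𝔩 ⊓ LinearMap.ker tr with h𝔩₀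
  have hmem₀ : ∀ X, X ∈ 𝔩₀ ↔ X ∈ 𝔩 ∧ tr X = 0 := fun X => by
    rw [h𝔩₀, Submodule.mem_inf, LinearMap.mem_ker]
  have htr1 : tr 1 = 2 := by
    rw [htr, LinearMap.trace_one, hW]; norm_num
  -- reduction `Y ↦ Y - (tr Y / 2) • 1 ∈ 𝔩₀`
  have hred : ∀ Y ∈ 𝔩, Y - ((2 : ℂ)⁻¹ * tr Y) • (1 : Module.End ℂ W) ∈ 𝔩₀ := fun Y hY => by
    rw [hmem₀]
    refine ⟨Submodule.sub_mem _ hY (Submodule.smul_mem _ _ h1), ?_⟩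
    rw [map_sub, map_smul, htr1, smul_eq_mul]
    ring
  -- an `𝔩₀`-stable subspace is `𝔩`-stable
  have hstab : ∀ U : Submodule ℂ W, (∀ X ∈ 𝔩₀, ∀ u ∈ U, X u ∈ U) → ∀ Y ∈ 𝔩, ∀ u ∈ U, Y u ∈ U := by
    intro U hU Y hY u hu
    have h := hU _ (hred Y hY) u hu
    rw [LinearMap.sub_apply, LinearMap.smul_apply, Module.End.one_apply] at h
    have h' : Y u = (Y u - ((2 : ℂ)⁻¹ * tr Y) • u) + ((2 : ℂ)⁻¹ * tr Y) • u := by abel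
    rw [h']
    exact Submodule.add_mem _ h (Submodule.smul_mem _ _ hu)
  -- eigenvectors
  have heigmem : ∀ (X : Module.End ℂ W) (c : ℂ), ∀ u ∈ X.eigenspace c, X u ∈ X.eigenspace c :=
    fun X c u hu => by
      rw [Module.End.mem_eigenspace_iff.1 hu]; exact Submodule.smul_mem _ _ hu
  -- a traceless `X` one of whose eigenspaces is `𝔩₀`-stable vanishes
  have hscalar : ∀ X ∈ 𝔩₀, ∀ c : ℂ, X.eigenspace c ≠ ⊥ →
      (∀ Y ∈ 𝔩₀, ∀ u ∈ X.eigenspace c, Y u ∈ X.eigenspace c) → X = 0 := by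
    intro X hX c hc hst
    have htop : X.eigenspace c = ⊤ := (hirr _ (hstab _ hst)).resolve_left hc
    have hXc : X = c • (1 : Module.End ℂ W) := by
      refine LinearMap.ext fun w => ?_
      have hw : w ∈ X.eigenspace c := htop ▸ Submodule.mem_top
      rw [Module.End.mem_eigenspace_iff] at hw
      rw [hw, LinearMap.smul_apply, Module.End.one_apply]
    have h0 : tr X = 0 := ((hmem₀ X).1 hX).2
    rw [hXc, map_smul, htr1, smul_eq_mul, mul_eq_zero] at h0
    rw [hXc, h0.resolve_right two_ne_zero, zero_smul]
  -- every operator has a non-zero eigenspace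
  have heig : ∀ X : Module.End ℂ W, ∃ c : ℂ, X.eigenspace c ≠ ⊥ := fun X => by
    obtain ⟨c, hc⟩ := Module.End.exists_eigenvalue X
    exact ⟨c, hc⟩
  -- Step 1: `𝔩₀ ≠ 0`
  have h𝔩₀ne : 𝔩₀ ≠ ⊥ := by
    intro h0
    obtain ⟨v, hv⟩ := exists_ne (0 : W)
    have hst : ∀ Y ∈ 𝔩, ∀ u ∈ (ℂ ∙ v), Y u ∈ (ℂ ∙ v) := by
      refine hstab _ fun X hX u _ => ?_
      rw [h0, Submodule.mem_bot] at hX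
      rw [hX, LinearMap.zero_apply]
      exact Submodule.zero_mem _
    rcases hirr _ hst with h | h
    · exact hv ((Submodule.span_singleton_eq_bot).1 h)
    · have h2 := finrank_span_singleton (K := ℂ) hv
      rw [h, finrank_top, hW] at h2
      norm_num at h2
  obtain ⟨X, hX, hX0⟩ := (Submodule.ne_bot_iff 𝔩₀).1 h𝔩₀ne
  -- Step 2: `𝔩₀` is not the line `ℂ X`
  have hnot1 : ∃ Y ∈ 𝔩₀, Y ∉ (ℂ ∙ X) := by
    by_contra hcon
    push Not at hcon
    obtain ⟨c, hc⟩ := heig X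
    refine hX0 (hscalar X hX c hc fun Y hY u hu => ?_)
    obtain ⟨a, rfl⟩ := Submodule.mem_span_singleton.1 (hcon Y hY)
    rw [LinearMap.smul_apply]
    exact Submodule.smul_mem _ _ (heigmem X c u hu)
  obtain ⟨Y, hY, hYX⟩ := hnot1
  -- Step 3: `𝔩₀` is not the plane `ℂ X + ℂ Y`
  have hnot2 : ∃ Z ∈ 𝔩₀, Z ∉ Submodule.span ℂ {X, Y} := by
    by_contra hcon
    push Not at hcon
    -- the bracket `C = [X, Y] = a X + b Y`
    set C := X * Y - Y * X with hCdef
    have hC𝔩₀ : C ∈ 𝔩₀ := by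
      rw [hmem₀]
      refine ⟨hbr X ((hmem₀ X).1 hX).1 Y ((hmem₀ Y).1 hY).1, ?_⟩
      rw [hCdef, map_sub, htr, LinearMap.trace_mul_comm, sub_self]
    obtain ⟨a, b, hab⟩ := Submodule.mem_span_pair.1 (hcon C hC𝔩₀)
    by_cases hC0 : C = 0
    · -- `X` and `Y` commute: an eigenspace of `X` is stable under `X` and `Y`
      have hXY : X * Y = Y * X := sub_eq_zero.1 (hCdef ▸ hC0)
      obtain ⟨c, hc⟩ := heig X
      refine hX0 (hscalar X hX c hc fun Z hZ u hu => ?_)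
      obtain ⟨a', b', rfl⟩ := Submodule.mem_span_pair.1 (hcon Z hZ)
      rw [LinearMap.add_apply, LinearMap.smul_apply, LinearMap.smul_apply]
      refine Submodule.add_mem _ (Submodule.smul_mem _ _ (heigmem X c u hu)) (Submodule.smul_mem _ _ ?_)
      rw [Module.End.mem_eigenspace_iff] at hu ⊢
      rw [← Module.End.mul_apply, hXY, Module.End.mul_apply, hu, map_smul]
    · -- `C ≠ 0`: `tr(C²) = 0`, so `C² = 0` and `ker C` is a stable line
      have htrCX : tr (C * X) = 0 := by
        rw [hCdef, sub_mul, map_sub, mul_assoc X Y X, htr, LinearMap.trace_mul_comm ℂ X (Y * X), mul_assoc,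
          sub_self]
      have htrCY : tr (C * Y) = 0 := by
        rw [hCdef, sub_mul, map_sub, mul_assoc X Y Y, mul_assoc Y X Y, htr, LinearMap.trace_mul_comm ℂ Y (X * Y),
          mul_assoc, sub_self]
      have htrCC : tr (C * C) = 0 := by
        have h : C * C = a • (C * X) + b • (C * Y) := by
          rw [← mul_smul_comm, ← mul_smul_comm, ← mul_add, hab]
        rw [h, map_add, map_smul, map_smul, htrCX, htrCY, smul_zero, smul_zero, add_zero]
      have hCC : C * C = 0 :=
        QuarticTheta.mul_self_eq_zero_of_trace_eq_zero hW ((hmem₀ C).1 hC𝔩₀).2 htrCC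
      -- `[X, C] = b C`, `[Y, C] = -a C`
      have hXC : X * C - C * X = b • C := by
        conv_lhs => rw [← hab]
        rw [mul_add, add_mul, mul_smul_comm, mul_smul_comm, smul_mul_assoc, smul_mul_assoc, hCdef]
        module
      have hYC : Y * C - C * Y = -(a • C) := by
        conv_lhs => rw [← hab]
        rw [mul_add, add_mul, mul_smul_comm, mul_smul_comm, smul_mul_assoc, smul_mul_assoc, hCdef]
        module
      have hst : ∀ Z ∈ 𝔩₀, ∀ u ∈ LinearMap.ker C, Z u ∈ LinearMap.ker C := by
        intro Z hZ u hu
        obtain ⟨a', b', rfl⟩ := Submodule.mem_span_pair.1 (hcon Z hZ)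
        rw [LinearMap.mem_ker] at hu ⊢
        have hXu : C (X u) = 0 := by
          have h := congrArg (fun T : Module.End ℂ W => T u) hXC
          simp only [LinearMap.sub_apply, Module.End.mul_apply, LinearMap.smul_apply, hu, map_zero,
            smul_zero, zero_sub, neg_eq_zero] at h
          exact h
        have hYu : C (Y u) = 0 := by
          have h := congrArg (fun T : Module.End ℂ W => T u) hYC
          simp only [LinearMap.sub_apply, Module.End.mul_apply, LinearMap.smul_apply, LinearMap.neg_apply, hu,
            map_zero, smul_zero, zero_sub, neg_zero, neg_eq_zero] at h
          exact h
        rw [LinearMap.add_apply, LinearMap.smul_apply, LinearMap.smul_apply, map_add, map_smul, map_smul, hXu,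
          hYu, smul_zero, smul_zero, add_zero]
      rcases hirr _ (hstab _ hst) with h | h
      · -- `ker C = 0`: but `C (C w) = 0` forces `C = 0`
        apply hC0
        refine LinearMap.ext fun w => ?_
        have hw : C w ∈ LinearMap.ker C := by
          rw [LinearMap.mem_ker, ← Module.End.mul_apply, hCC, LinearMap.zero_apply]
        rw [h, Submodule.mem_bot] at hw
        rw [hw, LinearMap.zero_apply]
      · exact hC0 (LinearMap.ker_eq_top.1 h)
  obtain ⟨Z, hZ, hZXY⟩ := hnot2
  -- Step 4: `dim 𝔩₀ ≥ 3 = dim ker tr`, so `𝔩₀ = ker tr` and `𝔩 = End W`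
  have hXY𝔩₀ : Submodule.span ℂ {X, Y} ≤ 𝔩₀ := by
    rw [Submodule.span_le]
    intro T hT
    rcases hT with rfl | rfl
    · exact hX
    · exact hY
  have h3 : 3 ≤ Module.finrank ℂ 𝔩₀ := by
    have hlt1 : (ℂ ∙ X) < Submodule.span ℂ {X, Y} := by
      refine lt_of_le_of_ne (Submodule.span_mono (Set.singleton_subset_iff.2 (Set.mem_insert X {Y}))) ?_
      intro h
      exact hYX (h ▸ Submodule.subset_span (Set.mem_insert_of_mem X rfl))
    have hlt2 : Submodule.span ℂ {X, Y} < 𝔩₀ := lt_of_le_of_ne hXY𝔩₀ fun h => hZXY (h ▸ hZ)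
    have h1' := finrank_span_singleton (K := ℂ) hX0
    have h2' := Submodule.finrank_lt_finrank_of_lt hlt1
    have h3' := Submodule.finrank_lt_finrank_of_lt hlt2
    omega
  have hker : Module.finrank ℂ (LinearMap.ker tr) = 3 := by
    have hsurj : LinearMap.range tr = ⊤ := by
      rw [LinearMap.range_eq_top]
      intro c
      refine ⟨((2 : ℂ)⁻¹ * c) • 1, ?_⟩
      rw [map_smul, htr1, smul_eq_mul]
      ring
    have h := LinearMap.finrank_range_add_finrank_ker tr
    rw [hsurj, finrank_top, Module.finrank_self, Module.finrank_linearMap, hW] at h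
    omega
  have h𝔩₀eq : 𝔩₀ = LinearMap.ker tr :=
    Submodule.eq_of_le_of_finrank_le inf_le_right (by rw [hker]; exact h3)
  rw [eq_top_iff]
  intro T _
  have hT : T = (T - ((2 : ℂ)⁻¹ * tr T) • 1) + ((2 : ℂ)⁻¹ * tr T) • (1 : Module.End ℂ W) := by abel
  rw [hT]
  refine Submodule.add_mem _ ?_ (Submodule.smul_mem _ _ h1)
  have hmem : T - ((2 : ℂ)⁻¹ * tr T) • (1 : Module.End ℂ W) ∈ LinearMap.ker tr := by
    rw [LinearMap.mem_ker, map_sub, map_smul, htr1, smul_eq_mul]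
    ring
  rw [← h𝔩₀eq] at hmem
  exact ((hmem₀ _).1 hmem).1

end GL2

/-! ### §2 Eigenspaces of `φ_ℂ`, the action of `E = ℚ[φ]`, orthogonality, the four-space decomposition -/

section Eigen

universe u

variable {V : Type u} [AddCommGroup V] [Module ℚ V] {n : ℤ}

/-- Rational scalars act on `V_ℂ` through `ℚ ⊆ ℂ`. [folklore] -/
private theorem QuarticTheta.ratCast_smul (q : ℚ) (z : ℂ ⊗[ℚ] V) : (q : ℂ) • z = q • z := by
  rw [← algebraMap_smul ℂ q z, eq_ratCast]

/-- On `W_c = ker(φ_ℂ - c)` the powers act by `(φ^k)_ℂ w = c^k w`. [cite: Deligne1982HodgeCycles, §4 (p. 30)] -/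
theorem QuarticTheta.baseChange_pow_apply (φ : Module.End ℚ V) {c : ℂ} {w : ℂ ⊗[ℚ] V}
    (hw : w ∈ Module.End.eigenspace (φ.baseChange ℂ) c) (k : ℕ) :
    (φ ^ k).baseChange ℂ w = c ^ k • w := by
  rw [Module.End.mem_eigenspace_iff] at hw
  induction k with
  | zero => rw [pow_zero, pow_zero, LinearMap.baseChange_one, one_smul, Module.End.one_apply]
  | succ k ih =>
    rw [pow_succ, pow_succ, LinearMap.baseChange_mul, Module.End.mul_apply, hw, map_smul, ih, smul_smul,
      mul_comm]

/-- **`E = ℚ[φ]` acts on each eigenspace `W_c` of `φ_ℂ` by scalars**: for `a = Σ_k q_k φ^k ∈ End_Hdg(V)`,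
`a_ℂ|_{W_c} = Σ_k q_k c^k` (Deligne §4: `E ⊗ ℂ = ℂ^{Hom(E,ℂ)}` acts on `H¹_σ` through `σ`).
[cite: Deligne1982HodgeCycles, §4 (p. 30)] -/
theorem QuarticTheta.exists_smul_of_mem_endAlg (H : HodgeStructure V n) {φ : Module.End ℚ V}
    (hE : ∀ a ∈ H.endAlg, ∃ q : Fin 4 → ℚ, a = ∑ k, q k • φ ^ (k : ℕ)) {a : Module.End ℚ V}
    (ha : a ∈ H.endAlg) (c : ℂ) :
    ∃ s : ℂ, ∀ w ∈ Module.End.eigenspace (φ.baseChange ℂ) c, a.baseChange ℂ w = s • w := by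
  obtain ⟨q, rfl⟩ := hE a ha
  refine ⟨∑ k, (q k : ℂ) * c ^ (k : ℕ), fun w hw => ?_⟩
  rw [Finset.sum_smul]
  have h : ∀ s : Finset (Fin 4), (∑ k ∈ s, q k • φ ^ (k : ℕ)).baseChange ℂ w =
      ∑ k ∈ s, ((q k : ℂ) * c ^ (k : ℕ)) • w := by
    intro s
    induction s using Finset.induction_on with
    | empty => rw [Finset.sum_empty, Finset.sum_empty, LinearMap.baseChange_zero, LinearMap.zero_apply]
    | insert k s hk ih =>
      rw [Finset.sum_insert hk, Finset.sum_insert hk, LinearMap.baseChange_add, LinearMap.add_apply, ih,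
        LinearMap.baseChange_smul, LinearMap.smul_apply, QuarticTheta.baseChange_pow_apply φ hw,
        ← QuarticTheta.ratCast_smul, smul_smul]
  exact h Finset.univ

/-- Elements of `E_ℂ = span_ℂ {a_ℂ : a ∈ End_Hdg(V)}` act on each `W_c` by scalars. [cite: Deligne1982HodgeCycles, §4 (p. 30)] -/
theorem QuarticTheta.exists_smul_of_mem_span_endAlg (H : HodgeStructure V n) {φ : Module.End ℚ V}
    (hE : ∀ a ∈ H.endAlg, ∃ q : Fin 4 → ℚ, a = ∑ k, q k • φ ^ (k : ℕ)) {T : Module.End ℂ (ℂ ⊗[ℚ] V)}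
    (hT : T ∈ Submodule.span ℂ ((fun a : Module.End ℚ V => a.baseChange ℂ) '' (H.endAlg : Set _))) (c : ℂ) :
    ∃ s : ℂ, ∀ w ∈ Module.End.eigenspace (φ.baseChange ℂ) c, T w = s • w := by
  induction hT using Submodule.span_induction with
  | mem Z hZ =>
    obtain ⟨a, ha, rfl⟩ := hZ
    exact QuarticTheta.exists_smul_of_mem_endAlg H hE ha c
  | zero => exact ⟨0, fun w _ => by rw [LinearMap.zero_apply, zero_smul]⟩
  | add Z Z' _ _ hZ hZ' =>
    obtain ⟨s, hs⟩ := hZ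
    obtain ⟨s', hs'⟩ := hZ'
    exact ⟨s + s', fun w hw => by rw [LinearMap.add_apply, hs w hw, hs' w hw, add_smul]⟩
  | smul a Z _ hZ =>
    obtain ⟨s, hs⟩ := hZ
    exact ⟨a * s, fun w hw => by rw [LinearMap.smul_apply, hs w hw, smul_smul]⟩

/-- `W_{conj c} = conj W_c` is non-zero when `W_c` is (`φ_ℂ` is real). [cite: Deligne1982HodgeCycles, §4 (p. 30)] -/
theorem QuarticTheta.eigenspace_conj_ne_bot (φ : Module.End ℚ V) {c : ℂ}
    (hc : Module.End.eigenspace (φ.baseChange ℂ) c ≠ ⊥) :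
    Module.End.eigenspace (φ.baseChange ℂ) (starRingEnd ℂ c) ≠ ⊥ := by
  intro h
  apply hc
  rw [← EndAction.complexConj_eigenspace_baseChange] at h
  rw [← complexConj_complexConj (Module.End.eigenspace (φ.baseChange ℂ) c), h, complexConj_bot]

/-- **The Rosati involution is complex conjugation on `E`; `ψ_ℂ(W_a, W_b) = 0` unless `b = conj a`.** The adjoint
`φ† ∈ E` acts on `W_b` by a scalar `s`, and `ψ_ℂ(φ_ℂ x, y) = ψ_ℂ(x, φ†_ℂ y)` gives `(a - s) ψ_ℂ(x, y) = 0` for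
`x ∈ W_a`, `y ∈ W_b`; testing on `x = conj z`, `0 ≠ z ∈ W_b` of pure Hodge type (`W_b` is `Θ`-graded, and
`ψ_ℂ(conj z, z) ≠ 0` by the second Hodge–Riemann relation) gives `s = conj b`. (Mumford §21: the Rosati involution
of a CM field is complex conjugation; Deligne §4: `ψ` pairs `H¹_σ` with `H¹_{σ̄}`.) [cite: MumfordAV1970, §21]
[cite: Deligne1982HodgeCycles, §4 (p. 30)] [cite: VoisinHodgeI2002, §7.1.2 Def. 7.7] -/
theorem QuarticTheta.form_eq_zero_of_ne [Module.Finite ℚ V] (H : HodgeStructure V n) (hn : n = 1)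
    (heff : H.IsEffective) (ψ : H.Polarization) {φ : Module.End ℚ V} (hφE : φ ∈ H.endAlg)
    (hE : ∀ a ∈ H.endAlg, ∃ q : Fin 4 → ℚ, a = ∑ k, q k • φ ^ (k : ℕ))
    {Θ : Module.End ℂ (ℂ ⊗[ℚ] V)} (hΘ : ∀ p, ∀ x ∈ H.piece p (n - p), Θ x = ((2 * p - n : ℤ) : ℂ) • x)
    (hΘφ : Θ * φ.baseChange ℂ = φ.baseChange ℂ * Θ) {a b : ℂ} (hab : a ≠ starRingEnd ℂ b)
    (hb : Module.End.eigenspace (φ.baseChange ℂ) b ≠ ⊥) {x y : ℂ ⊗[ℚ] V}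
    (hx : x ∈ Module.End.eigenspace (φ.baseChange ℂ) a) (hy : y ∈ Module.End.eigenspace (φ.baseChange ℂ) b) :
    ψ.form.baseChange ℂ x y = 0 := by
  obtain ⟨hP, hQ, hΘ10, hΘ01, -⟩ := UnitaryTheta.theta_facts H hn heff hΘ
  subst hn
  set ψC := ψ.form.baseChange ℂ with hψC
  -- `φ†` acts on `W_b` by a scalar `s`
  obtain ⟨s, hs⟩ := QuarticTheta.exists_smul_of_mem_endAlg H hE (ψ.adjoint_mem_endAlg hφE) b
  have key : ∀ a' x' y', x' ∈ Module.End.eigenspace (φ.baseChange ℂ) a' →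
      y' ∈ Module.End.eigenspace (φ.baseChange ℂ) b → (a' - s) * ψC x' y' = 0 := by
    intro a' x' y' hx' hy'
    have h1 : ψC (φ.baseChange ℂ x') y' = a' * ψC x' y' := by
      rw [Module.End.mem_eigenspace_iff.1 hx', LinearMap.map_smul₂, smul_eq_mul]
    have h2 : ψC (φ.baseChange ℂ x') y' = s * ψC x' y' := by
      rw [hψC, isAdjointPair_baseChange (ψ.isAdjointPair_adjoint φ) x' y', hs y' hy', map_smul, smul_eq_mul]
    linear_combination h2 - h1
  -- `s = conj b`: test against a non-zero vector of pure type in `W_b`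
  have hsb : s = starRingEnd ℂ b := by
    obtain ⟨z, hz, hz0⟩ := (Submodule.ne_bot_iff _).1 hb
    have hΘz : Θ z ∈ Module.End.eigenspace (φ.baseChange ℂ) b :=
      UnitaryTheta.apply_mem_eigenspace_of_commute hΘφ hz
    have hPz : (2 : ℂ)⁻¹ • (z + Θ z) ∈ Module.End.eigenspace (φ.baseChange ℂ) b :=
      Submodule.smul_mem _ _ (Submodule.add_mem _ hz hΘz)
    have hQz : (2 : ℂ)⁻¹ • (z - Θ z) ∈ Module.End.eigenspace (φ.baseChange ℂ) b :=
      Submodule.smul_mem _ _ (Submodule.sub_mem _ hz hΘz)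
    -- one of `P z`, `Q z` is non-zero
    have hPQ : (2 : ℂ)⁻¹ • (z + Θ z) + (2 : ℂ)⁻¹ • (z - Θ z) = z := by module
    have htest : ∀ (p q : ℤ) (z₀ : ℂ ⊗[ℚ] V), p + q = 1 → z₀ ∈ H.piece p q →
        z₀ ∈ Module.End.eigenspace (φ.baseChange ℂ) b → z₀ ≠ 0 → s = starRingEnd ℂ b := by
      intro p q z₀ hpq hz₀ hz₀b hz₀0
      have hcz : conj z₀ ∈ Module.End.eigenspace (φ.baseChange ℂ) (starRingEnd ℂ b) := by
        rw [← EndAction.complexConj_eigenspace_baseChange, mem_complexConj, conj_conj]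
        exact hz₀b
      have hne : ψC (conj z₀) z₀ ≠ 0 := by
        have h := ψ.form_conj_ne_zero (by rw [← hpq, add_comm]) (H.conj_mem_piece hz₀)
          (fun h => hz₀0 (by rw [← conj_conj z₀, h, map_zero]))
        rwa [conj_conj] at h
      have h := key _ _ _ hcz hz₀b
      rcases mul_eq_zero.1 h with h | h
      · exact (sub_eq_zero.1 h).symm
      · exact absurd h hne
    by_cases hP0 : (2 : ℂ)⁻¹ • (z + Θ z) = 0
    · have hQ0 : (2 : ℂ)⁻¹ • (z - Θ z) ≠ 0 := by
        intro hQ0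
        exact hz0 (by rw [← hPQ, hP0, hQ0, add_zero])
      exact htest 0 1 _ (by norm_num) (hQ z) hQz hQ0
    · exact htest 1 0 _ (by norm_num) (hP z) hPz hP0
  have h := key a x y hx hy
  rw [hsb] at h
  rcases mul_eq_zero.1 h with h | h
  · exact absurd (sub_eq_zero.1 h) hab
  · exact h

/-- **The four-space decomposition `V_ℂ = W_{μ₁} ⊕ W_{conj μ₁} ⊕ W_{μ₂} ⊕ W_{conj μ₂}`** for multiplicities
`{(1,1), (2,0)}` on `dim V = 8`: each `W_c` is `Θ`-graded, `W_c = (W_c ∩ V^{1,0}) ⊕ (W_c ∩ V^{0,1})`, so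
`dim W_{μ₁} = 2 = dim W_{conj μ₁}`, `dim W_{μ₂} = dim W_{conj μ₂} ≥ 2`; distinct eigenspaces are independent, so the
dimension count forces `dim W_{μ₂} = 2`, `W_{μ₂} ⊆ V^{1,0}`, the four spaces span `V_ℂ`, and `W_{μ₁}`, `W_{μ₂}`
have the complementary sums as complements (Deligne §4: `H¹ ⊗ ℂ = ⊕_σ H¹_σ`, `dim H¹_σ = dim_E H¹`; MZ99 §1:
multiplicities `n_σ + n_σ̄ = m`). [cite: Deligne1982HodgeCycles, §4 (p. 30)] [cite: MoonenZarhin1999LowDim, §1] -/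
theorem QuarticTheta.eigenspace_facts [Module.Finite ℚ V] (H : HodgeStructure V n) (hn : n = 1)
    (heff : H.IsEffective) {φ : Module.End ℚ V} {Θ : Module.End ℂ (ℂ ⊗[ℚ] V)}
    (hΘ : ∀ p, ∀ x ∈ H.piece p (n - p), Θ x = ((2 * p - n : ℤ) : ℂ) • x)
    (hΘφ : Θ * φ.baseChange ℂ = φ.baseChange ℂ * Θ) {μ₁ μ₂ : ℂ}
    (h11 : starRingEnd ℂ μ₁ ≠ μ₁) (h22 : starRingEnd ℂ μ₂ ≠ μ₂) (h12 : μ₂ ≠ μ₁)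
    (h12' : μ₂ ≠ starRingEnd ℂ μ₁) (hV : Module.finrank ℚ V = 8)
    (h1a : Module.finrank ℂ ↥(Module.End.eigenspace (φ.baseChange ℂ) μ₁ ⊓ H.piece 1 0) = 1)
    (h1b : Module.finrank ℂ ↥(Module.End.eigenspace (φ.baseChange ℂ) μ₁ ⊓ H.piece 0 1) = 1)
    (h2a : Module.finrank ℂ ↥(Module.End.eigenspace (φ.baseChange ℂ) μ₂ ⊓ H.piece 1 0) = 2) :
    Module.End.eigenspace (φ.baseChange ℂ) μ₂ ≤ H.piece 1 0 ∧
    Module.finrank ℂ ↥(Module.End.eigenspace (φ.baseChange ℂ) μ₂) = 2 ∧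
    Module.End.eigenspace (φ.baseChange ℂ) μ₁ ⊔ Module.End.eigenspace (φ.baseChange ℂ) (starRingEnd ℂ μ₁) ⊔
      Module.End.eigenspace (φ.baseChange ℂ) μ₂ ⊔ Module.End.eigenspace (φ.baseChange ℂ) (starRingEnd ℂ μ₂) = ⊤ ∧
    IsCompl (Module.End.eigenspace (φ.baseChange ℂ) μ₁)
      (Module.End.eigenspace (φ.baseChange ℂ) (starRingEnd ℂ μ₁) ⊔ Module.End.eigenspace (φ.baseChange ℂ) μ₂ ⊔
        Module.End.eigenspace (φ.baseChange ℂ) (starRingEnd ℂ μ₂)) ∧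
    IsCompl (Module.End.eigenspace (φ.baseChange ℂ) μ₂)
      (Module.End.eigenspace (φ.baseChange ℂ) μ₁ ⊔ Module.End.eigenspace (φ.baseChange ℂ) (starRingEnd ℂ μ₁) ⊔
        Module.End.eigenspace (φ.baseChange ℂ) (starRingEnd ℂ μ₂)) := by
  obtain ⟨hP, hQ, hΘ10, hΘ01, -⟩ := UnitaryTheta.theta_facts H hn heff hΘ
  subst hn
  set F := φ.baseChange ℂ with hF
  have hΘW : ∀ c, ∀ w ∈ Module.End.eigenspace F c, Θ w ∈ Module.End.eigenspace F c := fun c w hw =>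
    UnitaryTheta.apply_mem_eigenspace_of_commute hΘφ hw
  -- the graded decomposition `W_c = (W_c ∩ V^{1,0}) ⊕ (W_c ∩ V^{0,1})`
  have hgr : ∀ c, Module.finrank ℂ ↥(Module.End.eigenspace F c) =
      Module.finrank ℂ ↥(Module.End.eigenspace F c ⊓ H.piece 1 0) +
        Module.finrank ℂ ↥(Module.End.eigenspace F c ⊓ H.piece 0 1) := by
    intro c
    have hsup : Module.End.eigenspace F c ⊓ H.piece 1 0 ⊔ Module.End.eigenspace F c ⊓ H.piece 0 1 =
        Module.End.eigenspace F c := by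
      refine le_antisymm (sup_le inf_le_left inf_le_left) fun w hw => ?_
      have h : (2 : ℂ)⁻¹ • (w + Θ w) + (2 : ℂ)⁻¹ • (w - Θ w) = w := by module
      rw [← h]
      exact Submodule.add_mem_sup ⟨Submodule.smul_mem _ _ (Submodule.add_mem _ hw (hΘW c w hw)), hP w⟩
        ⟨Submodule.smul_mem _ _ (Submodule.sub_mem _ hw (hΘW c w hw)), hQ w⟩
    have hinf : (Module.End.eigenspace F c ⊓ H.piece 1 0) ⊓ (Module.End.eigenspace F c ⊓ H.piece 0 1) = ⊥ := by
      rw [eq_bot_iff]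
      intro x hx
      rw [Submodule.mem_bot]
      have h1 := hΘ10 x hx.1.2
      have h2 := hΘ01 x hx.2.2
      rw [h1] at h2
      have h3 : (2 : ℂ) • x = 0 := by rw [two_smul]; nth_rewrite 2 [h2]; rw [add_neg_cancel]
      exact (smul_eq_zero.1 h3).resolve_left two_ne_zero
    have h := Submodule.finrank_sup_add_finrank_inf_eq (Module.End.eigenspace F c ⊓ H.piece 1 0)
      (Module.End.eigenspace F c ⊓ H.piece 0 1)
    rw [hsup, hinf, finrank_bot, add_zero] at h
    exact h
  -- conjugate eigenspaces have equal dimension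
  have hconj : ∀ c, Module.finrank ℂ ↥(Module.End.eigenspace F (starRingEnd ℂ c)) =
      Module.finrank ℂ ↥(Module.End.eigenspace F c) := fun c => by
    rw [hF, ← EndAction.complexConj_eigenspace_baseChange, finrank_complexConj]
  have hd1 : Module.finrank ℂ ↥(Module.End.eigenspace F μ₁) = 2 := by rw [hgr, h1a, h1b]
  have hd1' : Module.finrank ℂ ↥(Module.End.eigenspace F (starRingEnd ℂ μ₁)) = 2 := by rw [hconj, hd1]
  have hd2 : 2 ≤ Module.finrank ℂ ↥(Module.End.eigenspace F μ₂) := by rw [hgr, h2a]; omega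
  have hd2' : Module.finrank ℂ ↥(Module.End.eigenspace F (starRingEnd ℂ μ₂)) =
      Module.finrank ℂ ↥(Module.End.eigenspace F μ₂) := hconj μ₂
  -- independence of the eigenspaces
  have hle : ∀ a b, b ≠ a → Module.End.eigenspace F b ≤ ⨆ j ≠ a, Module.End.eigenspace F j := fun a b hba =>
    le_iSup₂_of_le (f := fun j (_ : j ≠ a) => Module.End.eigenspace F j) b hba le_rfl
  have hdisj : ∀ a (S : Submodule ℂ (ℂ ⊗[ℚ] V)), S ≤ ⨆ j ≠ a, Module.End.eigenspace F j →
      S ⊓ Module.End.eigenspace F a = ⊥ := fun a S hS =>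
    disjoint_iff.1 (((Module.End.eigenspaces_iSupIndep F) a).mono_right hS).symm
  have h21 : starRingEnd ℂ μ₂ ≠ μ₁ := fun h => h12' (by rw [← h, starRingEnd_self_apply])
  have h21' : starRingEnd ℂ μ₂ ≠ starRingEnd ℂ μ₁ := fun h => h12 (RingHom.injective _ h)
  -- the dimension count along `W₁ ⊕ W̄₁ ⊕ W₂ ⊕ W̄₂`
  have hs2 : Module.finrank ℂ ↥(Module.End.eigenspace F μ₁ ⊔ Module.End.eigenspace F (starRingEnd ℂ μ₁)) = 4 := by
    have h := Submodule.finrank_sup_add_finrank_inf_eq (Module.End.eigenspace F μ₁)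
      (Module.End.eigenspace F (starRingEnd ℂ μ₁))
    rw [hdisj _ _ (hle _ _ h11.symm), finrank_bot, add_zero, hd1, hd1'] at h
    exact h
  have hs3 : Module.finrank ℂ ↥(Module.End.eigenspace F μ₁ ⊔ Module.End.eigenspace F (starRingEnd ℂ μ₁) ⊔
      Module.End.eigenspace F μ₂) = 4 + Module.finrank ℂ ↥(Module.End.eigenspace F μ₂) := by
    have h := Submodule.finrank_sup_add_finrank_inf_eq
      (Module.End.eigenspace F μ₁ ⊔ Module.End.eigenspace F (starRingEnd ℂ μ₁)) (Module.End.eigenspace F μ₂)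
    rw [hdisj _ _ (sup_le (hle _ _ h12.symm) (hle _ _ h12'.symm)), finrank_bot, add_zero, hs2] at h
    exact h
  have hs4 : Module.finrank ℂ ↥(Module.End.eigenspace F μ₁ ⊔ Module.End.eigenspace F (starRingEnd ℂ μ₁) ⊔
      Module.End.eigenspace F μ₂ ⊔ Module.End.eigenspace F (starRingEnd ℂ μ₂)) =
        4 + 2 * Module.finrank ℂ ↥(Module.End.eigenspace F μ₂) := by
    have h := Submodule.finrank_sup_add_finrank_inf_eq
      (Module.End.eigenspace F μ₁ ⊔ Module.End.eigenspace F (starRingEnd ℂ μ₁) ⊔ Module.End.eigenspace F μ₂)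
      (Module.End.eigenspace F (starRingEnd ℂ μ₂))
    rw [hdisj _ _ (sup_le (sup_le (hle _ _ h21.symm) (hle _ _ h21'.symm)) (hle _ _ h22.symm)), finrank_bot,
      add_zero, hs3, hd2'] at h
    omega
  have hV' : Module.finrank ℂ (ℂ ⊗[ℚ] V) = 8 := by rw [Module.finrank_baseChange, hV]
  have hle8 := Submodule.finrank_le (Module.End.eigenspace F μ₁ ⊔ Module.End.eigenspace F (starRingEnd ℂ μ₁) ⊔
      Module.End.eigenspace F μ₂ ⊔ Module.End.eigenspace F (starRingEnd ℂ μ₂))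
  rw [hs4, hV'] at hle8
  have hf2 : Module.finrank ℂ ↥(Module.End.eigenspace F μ₂) = 2 := by omega
  have htop : Module.End.eigenspace F μ₁ ⊔ Module.End.eigenspace F (starRingEnd ℂ μ₁) ⊔
      Module.End.eigenspace F μ₂ ⊔ Module.End.eigenspace F (starRingEnd ℂ μ₂) = ⊤ :=
    Submodule.eq_top_of_finrank_eq (by rw [hs4, hf2, hV'])
  refine ⟨?_, hf2, htop, ?_, ?_⟩
  · have h : Module.End.eigenspace F μ₂ ⊓ H.piece 1 0 = Module.End.eigenspace F μ₂ :=
      Submodule.eq_of_le_of_finrank_le inf_le_left (by rw [hf2, h2a])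
    rw [← h]
    exact inf_le_right
  · refine IsCompl.of_eq ?_ ?_
    · rw [inf_comm]
      exact hdisj μ₁ _ (sup_le (sup_le (hle _ _ h11) (hle _ _ h12)) (hle _ _ h21))
    · rw [← sup_assoc, ← sup_assoc]
      exact htop
  · refine IsCompl.of_eq ?_ ?_
    · rw [inf_comm]
      exact hdisj μ₂ _ (sup_le (sup_le (hle _ _ h12.symm) (hle _ _ h12'.symm)) (hle _ _ h22))
    · rw [sup_left_comm, ← sup_assoc]
      exact htop

/-- **Determination by `W_{μ₁} ⊕ W_{μ₂}`** (`𝔨_ℂ → 𝔤𝔩(W_{μ₁}) × 𝔤𝔩(W_{μ₂})` is injective): an operator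
commuting with `φ_ℂ`, `ψ_ℂ`-skew and zero on `W_{μ₁}` and `W_{μ₂}` is zero — its values on `W_{conj μ₁}` lie in
`W_{conj μ₁}`, which pairs non-trivially only with `W_{μ₁}`, where skewness moves `D` to the other argument;
non-degeneracy of `ψ_ℂ`. (Gordon §6: "`MT(A, ℂ) → GL(W')`"; here with two blocks.)
[cite: Gordon1997, §6 (proof of Thm. 6.3.3, p. 19)] [cite: Deligne1982HodgeCycles, §4 (p. 30)] -/
theorem QuarticTheta.eq_zero_of_forall_eigenspace [Module.Finite ℚ V] (H : HodgeStructure V n) (hn : n = 1)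
    (heff : H.IsEffective) (ψ : H.Polarization) {φ : Module.End ℚ V} (hφE : φ ∈ H.endAlg)
    (hE : ∀ a ∈ H.endAlg, ∃ q : Fin 4 → ℚ, a = ∑ k, q k • φ ^ (k : ℕ))
    {Θ : Module.End ℂ (ℂ ⊗[ℚ] V)} (hΘ : ∀ p, ∀ x ∈ H.piece p (n - p), Θ x = ((2 * p - n : ℤ) : ℂ) • x)
    (hΘφ : Θ * φ.baseChange ℂ = φ.baseChange ℂ * Θ) {μ₁ μ₂ : ℂ}
    (h11 : starRingEnd ℂ μ₁ ≠ μ₁) (h22 : starRingEnd ℂ μ₂ ≠ μ₂) (h12 : μ₂ ≠ μ₁)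
    (h12' : μ₂ ≠ starRingEnd ℂ μ₁)
    (hne1 : Module.End.eigenspace (φ.baseChange ℂ) μ₁ ≠ ⊥) (hne2 : Module.End.eigenspace (φ.baseChange ℂ) μ₂ ≠ ⊥)
    (htop : Module.End.eigenspace (φ.baseChange ℂ) μ₁ ⊔ Module.End.eigenspace (φ.baseChange ℂ) (starRingEnd ℂ μ₁) ⊔
      Module.End.eigenspace (φ.baseChange ℂ) μ₂ ⊔ Module.End.eigenspace (φ.baseChange ℂ) (starRingEnd ℂ μ₂) = ⊤)
    {D : Module.End ℂ (ℂ ⊗[ℚ] V)} (hDφ : D * φ.baseChange ℂ = φ.baseChange ℂ * D)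
    (hDskew : ∀ x y, ψ.form.baseChange ℂ (D x) y + ψ.form.baseChange ℂ x (D y) = 0)
    (hD1 : ∀ w ∈ Module.End.eigenspace (φ.baseChange ℂ) μ₁, D w = 0)
    (hD2 : ∀ w ∈ Module.End.eigenspace (φ.baseChange ℂ) μ₂, D w = 0) : D = 0 := by
  set F := φ.baseChange ℂ with hF
  set ψC := ψ.form.baseChange ℂ with hψC
  have horth : ∀ {a b : ℂ}, a ≠ starRingEnd ℂ b → Module.End.eigenspace F b ≠ ⊥ → ∀ {x y : ℂ ⊗[ℚ] V},
      x ∈ Module.End.eigenspace F a → y ∈ Module.End.eigenspace F b → ψC x y = 0 :=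
    fun hab hb _ _ hx hy => QuarticTheta.form_eq_zero_of_ne H hn heff ψ hφE hE hΘ hΘφ hab hb hx hy
  have hne1' := QuarticTheta.eigenspace_conj_ne_bot φ hne1
  have hne2' := QuarticTheta.eigenspace_conj_ne_bot φ hne2
  have hcc1 : starRingEnd ℂ (starRingEnd ℂ μ₁) = μ₁ := starRingEnd_self_apply μ₁
  have hcc2 : starRingEnd ℂ (starRingEnd ℂ μ₂) = μ₂ := starRingEnd_self_apply μ₂
  have h21 : starRingEnd ℂ μ₂ ≠ μ₁ := fun h => h12' (by rw [← h, starRingEnd_self_apply])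
  have hdec : ∀ v : ℂ ⊗[ℚ] V, ∃ v₁ ∈ Module.End.eigenspace F μ₁, ∃ v₂ ∈ Module.End.eigenspace F (starRingEnd ℂ μ₁),
      ∃ v₃ ∈ Module.End.eigenspace F μ₂, ∃ v₄ ∈ Module.End.eigenspace F (starRingEnd ℂ μ₂),
        v = v₁ + v₂ + v₃ + v₄ := by
    intro v
    have hv : v ∈ Module.End.eigenspace F μ₁ ⊔ Module.End.eigenspace F (starRingEnd ℂ μ₁) ⊔
        Module.End.eigenspace F μ₂ ⊔ Module.End.eigenspace F (starRingEnd ℂ μ₂) := htop ▸ Submodule.mem_top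
    obtain ⟨u, hu, v₄, hv₄, rfl⟩ := Submodule.mem_sup.1 hv
    obtain ⟨u', hu', v₃, hv₃, rfl⟩ := Submodule.mem_sup.1 hu
    obtain ⟨v₁, hv₁, v₂, hv₂, rfl⟩ := Submodule.mem_sup.1 hu'
    exact ⟨v₁, hv₁, v₂, hv₂, v₃, hv₃, v₄, hv₄, rfl⟩
  have hDW : ∀ c, ∀ w ∈ Module.End.eigenspace F c, D w ∈ Module.End.eigenspace F c := fun c w hw =>
    UnitaryTheta.apply_mem_eigenspace_of_commute hDφ hw
  have hflip : ∀ x y, D x = 0 → ψC x (D y) = 0 := fun x y hx => by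
    have h := hDskew x y
    rwa [hx, map_zero, LinearMap.zero_apply, zero_add] at h
  -- `D` kills `W̄₁` and `W̄₂`
  have hD1' : ∀ y ∈ Module.End.eigenspace F (starRingEnd ℂ μ₁), D y = 0 := by
    intro y hy
    refine ψ.eq_zero_of_forall_form_eq_zero' fun x => ?_
    obtain ⟨x₁, hx₁, x₂, hx₂, x₃, hx₃, x₄, hx₄, rfl⟩ := hdec x
    have hDy := hDW _ y hy
    rw [map_add, map_add, map_add, LinearMap.add_apply, LinearMap.add_apply, LinearMap.add_apply,
      hflip x₁ y (hD1 x₁ hx₁), horth (by rw [hcc1]; exact h11) hne1' hx₂ hDy,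
      horth (by rw [hcc1]; exact h12) hne1' hx₃ hDy, horth (by rw [hcc1]; exact h21) hne1' hx₄ hDy]
    norm_num
  have hD2' : ∀ y ∈ Module.End.eigenspace F (starRingEnd ℂ μ₂), D y = 0 := by
    intro y hy
    refine ψ.eq_zero_of_forall_form_eq_zero' fun x => ?_
    obtain ⟨x₁, hx₁, x₂, hx₂, x₃, hx₃, x₄, hx₄, rfl⟩ := hdec x
    have hDy := hDW _ y hy
    rw [map_add, map_add, map_add, LinearMap.add_apply, LinearMap.add_apply, LinearMap.add_apply,
      horth (by rw [hcc2]; exact h12.symm) hne2' hx₁ hDy, horth (by rw [hcc2]; exact h12'.symm) hne2' hx₂ hDy,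
      hflip x₃ y (hD2 x₃ hx₃), horth (by rw [hcc2]; exact h22) hne2' hx₄ hDy]
    norm_num
  refine LinearMap.ext fun v => ?_
  obtain ⟨v₁, hv₁, v₂, hv₂, v₃, hv₃, v₄, hv₄, rfl⟩ := hdec v
  rw [map_add, map_add, map_add, hD1 v₁ hv₁, hD1' v₂ hv₂, hD2 v₃ hv₃, hD2' v₄ hv₄, LinearMap.zero_apply]
  norm_num

/-- **`𝔤_ℂ ∩ E_ℂ = (𝔤 ∩ E)_ℂ`, existence half**: a non-zero element of `spanC 𝔤 ∩ span_ℂ End_Hdg(V)_ℂ` has a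
non-zero rational coordinate (`ratCoord`, in a `ℚ`-basis of `ℂ`) lying in `𝔤 ∩ End_Hdg(V)` (Deligne I §3: rational
structures are compatible with base change; the tree's `ratCoord_mem_of_mem_baseChange`).
[cite: Deligne1982HodgeCycles, I §3 (proof of Prop. 3.4)] -/
theorem QuarticTheta.exists_rat_of_mem_spanC_of_mem_span_endAlg [Module.Finite ℚ V] (H : HodgeStructure V n)
    (𝔤 : Submodule ℚ (Module.End ℚ V)) {Z : Module.End ℂ (ℂ ⊗[ℚ] V)} (hZ𝔤 : Z ∈ spanC 𝔤)
    (hZE : Z ∈ Submodule.span ℂ ((fun a : Module.End ℚ V => a.baseChange ℂ) '' (H.endAlg : Set _)))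
    (hZ0 : Z ≠ 0) : ∃ t ∈ 𝔤, t ∈ H.endAlg ∧ t ≠ 0 := by
  set ξ := (endBaseChangeEquiv V).symm Z with hξ
  have hξ𝔤 : ξ ∈ 𝔤.baseChange ℂ := endBaseChangeEquiv_symm_mem_baseChange 𝔤 hZ𝔤
  have hξE : ξ ∈ (Subalgebra.toSubmodule H.endAlg).baseChange ℂ :=
    endBaseChangeEquiv_symm_mem_baseChange (Subalgebra.toSubmodule H.endAlg)
      (by rw [Subalgebra.coe_toSubmodule]; exact hZE)
  obtain ⟨i, hi⟩ : ∃ i, ratCoord (Module.End ℚ V) ξ i ≠ 0 := by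
    by_contra hcon
    push Not at hcon
    have hξ0 : ξ = 0 :=
      (ratCoord (Module.End ℚ V)).injective (by rw [map_zero]; ext j; rw [hcon j, Finsupp.zero_apply])
    exact hZ0 (by rw [show Z = endBaseChangeEquiv V ξ by rw [hξ, LinearEquiv.apply_symm_apply], hξ0, map_zero])
  refine ⟨ratCoord (Module.End ℚ V) ξ i, ratCoord_mem_of_mem_baseChange _ hξ𝔤 i, ?_, hi⟩
  have h := ratCoord_mem_of_mem_baseChange _ hξE i
  rwa [Subalgebra.mem_toSubmodule] at h

end Eigen

/-! ### §3 Irreducibility of the eigenspaces `W_c` under `𝔤` -/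

section Irreducible

universe u

variable {V : Type u} [AddCommGroup V] [Module ℚ V] {n : ℤ}

/-- **Irreducibility of an eigenspace `W_c` under `𝔤`.** Let `R` be a `𝔤`-stable complement of `W_c` in `V_ℂ`.
A subspace `U ≤ W_c` stable under the `X_ℂ`, `X ∈ 𝔤`, is `0` or `W_c`: `U` is `Θ`-graded (`Θ ∈ 𝔤_ℂ`),
`U† = {y ∈ W_c : ψ_ℂ(y, conj U) = 0}` is stable (the `X_ℂ` are real and skew) with `U ∩ U† = 0` (second
Hodge–Riemann relation on the graded pieces) and `dim U† ≥ dim W_c - dim U`, so `V_ℂ = U ⊕ (U† ⊕ R)` and the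
projector onto `U` commutes with `𝔤`, hence lies in `E_ℂ` (`ThetaSubalgebra.mem_span_endAlg_of_forall_commute`),
hence is a scalar on `W_c` (`exists_smul_of_mem_span_endAlg`). (The proof of `UnitaryTheta.eq_bot_or_eq_of_stable`
with `W'` replaced by `R`; Gordon §6, Zarhin §2.) [cite: Gordon1997, §6 (proof of Thm. 6.3.3, p. 19)]
[cite: Zarhin1983HodgeGroupsK3, §2] [cite: VoisinHodgeI2002, §7.1.2 Def. 7.7] -/
theorem QuarticTheta.eq_bot_or_eq_of_stable [Module.Finite ℚ V] (H : HodgeStructure V n) (hn : n = 1)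
    (heff : H.IsEffective) (ψ : H.Polarization) {φ : Module.End ℚ V} (hφE : φ ∈ H.endAlg)
    (hE : ∀ a ∈ H.endAlg, ∃ q : Fin 4 → ℚ, a = ∑ k, q k • φ ^ (k : ℕ))
    (𝔤 : Submodule ℚ (Module.End ℚ V)) {Θ : Module.End ℂ (ℂ ⊗[ℚ] V)}
    (hΘ : ∀ p, ∀ x ∈ H.piece p (n - p), Θ x = ((2 * p - n : ℤ) : ℂ) • x) (hΘ𝔤 : Θ ∈ spanC 𝔤)
    (hcomm : ∀ X ∈ 𝔤, ∀ a : H.endAlg, X * (a : Module.End ℚ V) = (a : Module.End ℚ V) * X)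
    (hskew : ∀ X ∈ 𝔤, ∀ v w, ψ.form (X v) w + ψ.form v (X w) = 0)
    {c : ℂ} {R : Submodule ℂ (ℂ ⊗[ℚ] V)} (hR : ∀ X ∈ 𝔤, ∀ r ∈ R, X.baseChange ℂ r ∈ R)
    (hcR : IsCompl (Module.End.eigenspace (φ.baseChange ℂ) c) R)
    {U : Submodule ℂ (ℂ ⊗[ℚ] V)} (hUW : U ≤ Module.End.eigenspace (φ.baseChange ℂ) c)
    (hU : ∀ X ∈ 𝔤, ∀ u ∈ U, X.baseChange ℂ u ∈ U) :
    U = ⊥ ∨ U = Module.End.eigenspace (φ.baseChange ℂ) c := by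
  subst hn
  classical
  set W := Module.End.eigenspace (φ.baseChange ℂ) c with hWdef
  set ψC := ψ.form.baseChange ℂ with hψC
  obtain ⟨hP, hQ, -, -, -⟩ := UnitaryTheta.theta_facts H rfl heff hΘ
  have hPQ : ∀ v, (2 : ℂ)⁻¹ • (v + Θ v) + (2 : ℂ)⁻¹ • (v - Θ v) = v := fun v => by module
  -- stability under `𝔤_ℂ ∋ Θ`; graded pieces
  have hXW : ∀ X ∈ 𝔤, ∀ w ∈ W, X.baseChange ℂ w ∈ W := fun X hX w hw =>
    UnitaryTheta.apply_mem_eigenspace_of_commute (UnitaryTheta.baseChange_commute H hφE hcomm hX) hw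
  have hXskew : ∀ X ∈ 𝔤, ∀ x y, ψC (X.baseChange ℂ x) y + ψC x (X.baseChange ℂ y) = 0 :=
    fun X hX => ThetaSubalgebra.formBaseChange_add_eq_zero_of_skew ψ (hskew X hX)
  have hgraded : ∀ T : Submodule ℂ (ℂ ⊗[ℚ] V), (∀ X ∈ 𝔤, ∀ u ∈ T, X.baseChange ℂ u ∈ T) →
      ∀ u ∈ T, (2 : ℂ)⁻¹ • (u + Θ u) ∈ T ∧ (2 : ℂ)⁻¹ • (u - Θ u) ∈ T := by
    intro T hT u hu
    have hΘu : Θ u ∈ T := mapsTo_of_mem_spanC (T := T) (fun X hX => fun u hu => hT X hX u hu) hΘ𝔤 hu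
    exact ⟨Submodule.smul_mem _ _ (Submodule.add_mem _ hu hΘu),
      Submodule.smul_mem _ _ (Submodule.sub_mem _ hu hΘu)⟩
  -- the trivial case
  by_cases hU0 : U = ⊥
  · exact Or.inl hU0
  right
  obtain ⟨u₀, hu₀U, hu₀0⟩ := (Submodule.ne_bot_iff U).1 hU0
  -- the `h`-orthogonal `U† = {y ∈ W : ψ_ℂ(y, conj U) = 0}`
  set Ud : Submodule ℂ (ℂ ⊗[ℚ] V) :=
    W ⊓ ⨅ u : U, LinearMap.ker (ψC.flip (conj (u : ℂ ⊗[ℚ] V))) with hUddef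
  have hmemUd : ∀ y, y ∈ Ud ↔ y ∈ W ∧ ∀ u ∈ U, ψC y (conj u) = 0 := fun y => by
    simp only [hUddef, Submodule.mem_inf, Submodule.mem_iInf, LinearMap.mem_ker, Subtype.forall]
    exact Iff.rfl
  have hUdW : Ud ≤ W := inf_le_left
  have hXUd : ∀ X ∈ 𝔤, ∀ y ∈ Ud, X.baseChange ℂ y ∈ Ud := by
    intro X hX y hy
    rw [hmemUd] at hy ⊢
    refine ⟨hXW X hX y hy.1, fun u hu => ?_⟩
    have h := hXskew X hX y (conj u)
    rwa [← conj_baseChange, hy.2 _ (hU X hX u hu), add_zero] at h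
  -- `U ∩ U† = 0`
  have hUUd : ∀ u ∈ U, u ∈ Ud → u = 0 := by
    intro u hu hud
    have key : ∀ z ∈ U, z ∈ Ud → ∀ p q : ℤ, p + q = 1 → z ∈ H.piece p q → z = 0 := by
      intro z hz hzd p q hpq hzpq
      by_contra hz0
      exact ψ.form_conj_ne_zero hpq hzpq hz0 (((hmemUd z).1 hzd).2 z hz)
    have h1 := key _ (hgraded U hU u hu).1 (hgraded Ud hXUd u hud).1 1 0 (by norm_num) (hP u)
    have h2 := key _ (hgraded U hU u hu).2 (hgraded Ud hXUd u hud).2 0 1 (by norm_num) (hQ u)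
    rw [← hPQ u, h1, h2, add_zero]
  -- `dim W ≤ dim U + dim U†`
  have hdim : Module.finrank ℂ W ≤ Module.finrank ℂ U + Module.finrank ℂ Ud := by
    set b := Module.finBasis ℂ U with hbdef
    set f : W →ₗ[ℂ] (Fin (Module.finrank ℂ U) → ℂ) :=
      LinearMap.pi fun i => (ψC.flip (conj (b i : ℂ ⊗[ℚ] V))).comp W.subtype with hfdef
    have hf : ∀ (w : W) i, f w i = ψC w (conj (b i : ℂ ⊗[ℚ] V)) := fun w i => rfl
    have hker : LinearMap.ker f ≤ Ud.comap W.subtype := by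
      intro w hw
      rw [LinearMap.mem_ker] at hw
      rw [Submodule.mem_comap, Submodule.subtype_apply, hmemUd]
      refine ⟨w.2, fun u hu => ?_⟩
      have hu' : u = ∑ i, b.repr ⟨u, hu⟩ i • (b i : ℂ ⊗[ℚ] V) := by
        have h := congrArg Subtype.val (b.sum_repr ⟨u, hu⟩).symm
        simpa only [Submodule.coe_sum, Submodule.coe_smul] using h
      rw [hu', map_sum, map_sum]
      refine Finset.sum_eq_zero fun i _ => ?_
      have hi := congrFun hw i
      rw [Pi.zero_apply, hf] at hi
      rw [conj_smul, map_smul, smul_eq_mul, hi, mul_zero]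
    have h1 := LinearMap.finrank_range_add_finrank_ker f
    have h2 : Module.finrank ℂ (LinearMap.range f) ≤ Module.finrank ℂ U :=
      (Submodule.finrank_le _).trans (Module.finrank_fin_fun ℂ).le
    have h3 : Module.finrank ℂ (LinearMap.ker f) ≤ Module.finrank ℂ Ud :=
      (Submodule.finrank_mono hker).trans (Submodule.comapSubtypeEquivOfLe hUdW).finrank_eq.le
    omega
  -- `W = U ⊕ U†`
  have hsup : U ⊔ Ud = W := by
    refine Submodule.eq_of_le_of_finrank_le (sup_le hUW hUdW) ?_
    have h := Submodule.finrank_sup_add_finrank_inf_eq U Ud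
    have h0 : U ⊓ Ud = ⊥ := by
      rw [eq_bot_iff]
      intro u hu
      rw [Submodule.mem_bot]
      exact hUUd u hu.1 hu.2
    rw [h0, finrank_bot, add_zero] at h
    omega
  -- `V_ℂ = U ⊕ (U† ⊕ R)`
  have hc : IsCompl U (Ud ⊔ R) := by
    refine IsCompl.of_le (fun x hx => ?_) (fun x _ => ?_)
    · obtain ⟨hxU, hx2⟩ := Submodule.mem_inf.1 hx
      obtain ⟨y, hy, z, hz, rfl⟩ := Submodule.mem_sup.1 hx2
      have hzW : z ∈ W := by
        have h : y + z - y ∈ W := Submodule.sub_mem _ (hUW hxU) (hUdW hy)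
        rwa [add_sub_cancel_left] at h
      have hz0 : z = 0 := by
        have h := hcR.disjoint
        rw [Submodule.disjoint_def] at h
        exact h z hzW hz
      rw [hz0, add_zero] at hxU ⊢
      rw [Submodule.mem_bot]
      exact hUUd y hxU hy
    · have hx : x ∈ W ⊔ R := hcR.sup_eq_top ▸ Submodule.mem_top
      obtain ⟨w, hw, r, hr, rfl⟩ := Submodule.mem_sup.1 hx
      rw [← sup_assoc, hsup]
      exact Submodule.add_mem_sup hw hr
  -- the projector onto `U` commutes with `𝔤`
  set π := U.projection (Ud ⊔ R) hc with hπ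
  have hπcomm : ∀ X ∈ 𝔤, π * X.baseChange ℂ = X.baseChange ℂ * π := by
    intro X hX
    refine LinearMap.ext fun x => ?_
    rw [Module.End.mul_apply, Module.End.mul_apply]
    have hx : x = π x + (x - π x) := by abel
    have h1 : π x ∈ U := Submodule.projection_apply_mem hc x
    have h2 : X.baseChange ℂ (x - π x) ∈ Ud ⊔ R := by
      obtain ⟨y, hy, z, hz, hyz⟩ := Submodule.mem_sup.1 (Submodule.sub_projection_mem hc x)
      rw [← hyz, map_add]
      exact Submodule.add_mem_sup (hXUd X hX y hy) (hR X hX z hz)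
    conv_lhs => rw [hx]
    rw [map_add, map_add, Submodule.projection_apply_of_mem_left hc (hU X hX _ h1),
      (Submodule.projection_apply_eq_zero_iff hc).2 h2, add_zero]
  -- hence lies in `E_ℂ` and is a scalar on `W`
  obtain ⟨s, hπW⟩ := QuarticTheta.exists_smul_of_mem_span_endAlg H hE
    (ThetaSubalgebra.mem_span_endAlg_of_forall_commute H 𝔤 hΘ hΘ𝔤 hπcomm) c
  have hs : s = 1 := by
    have h := hπW u₀ (hUW hu₀U)
    rw [Submodule.projection_apply_of_mem_left hc hu₀U] at h
    have h' : (s - 1) • u₀ = 0 := by rw [sub_smul, one_smul, ← h, sub_self]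
    exact sub_eq_zero.1 ((smul_eq_zero.1 h').resolve_right hu₀0)
  refine le_antisymm hUW fun w hw => ?_
  rw [← one_smul ℂ w, ← hs, ← hπW w hw]
  exact Submodule.projection_apply_mem hc w

end Irreducible


/-! ### §4 The main theorem: `𝔤_ℂ = 𝔲_E(V, ψ)_ℂ` -/

section Main

universe u

variable {V : Type u} [AddCommGroup V] [Module ℚ V] {n : ℤ}

/-- **Theorem (`𝔤_ℂ = 𝔲_E(V,ψ)_ℂ` for a quartic CM field `E` with multiplicities `{(1,1),(2,0)}`; the Lie step of
Moonen–Zarhin 1999 Thm. (0.2)(4) for simple Type IV(2,1), for an arbitrary rational Lie algebra).** Let `H` be an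
effective polarized `ℚ`-Hodge structure of weight `1`, `dim V = 8`, with `End_Hdg(V) = ℚ[φ] = Σ_{k<4} ℚφ^k` a field
(left inverses), `μ₁, conj μ₁, μ₂, conj μ₂` pairwise distinct, `dim(W_{μ₁} ∩ V^{1,0}) = dim(W_{μ₁} ∩ V^{0,1}) = 1`,
`dim(W_{μ₂} ∩ V^{1,0}) = 2`. Let `𝔤 ⊆ End_ℚ(V)` be a bracket-closed `ℚ`-subspace of operators commuting with
`End_Hdg(V)` and `ψ`-skew whose complex span contains a Hodge operator `Θ`. Then every `ψ_ℂ`-skew operator `Y` of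
`V_ℂ` commuting with `φ_ℂ` lies in `𝔤_ℂ`. Proof: the PROOF paragraph of the module docstring (`E₊, E₋, H₁ = [E₊,E₋], ζ = Θ - H₁`,
a rational `t ∈ 𝔤 ∩ E`, `I₁`, then `𝔤𝔩(W_{μ₁})` by hand and `𝔤𝔩(W_{μ₂})` by `eq_top_of_forall_stable`, and
determination). (MZ99 (0.2)(4): "`Hg(X) = Sp_D(V,φ)` and `B(Xⁿ) = D(Xⁿ)` for all `n`" outside the cases (a)–(d);
(2.4): proved for simple fourfolds in MZ95.) [cite: MoonenZarhin1999LowDim, Thm. (0.2)(4) and §2 (2.4)]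
[cite: MoonenZarhin1995Duke, Thm. (0.2) for simple fourfolds (via MZ99 (2.4))] [cite: Gordon1997, §6 (proof of Thm. 6.3.3, pp. 18–19)]
[cite: Deligne1982HodgeCycles, I §3 Prop. 3.4 and §4] -/
theorem QuarticTheta.mem_spanC_of_commute_of_skew [Module.Finite ℚ V] (H : HodgeStructure V n) (hn : n = 1)
    (heff : H.IsEffective) (ψ : H.Polarization) {φ : Module.End ℚ V} (hφE : φ ∈ H.endAlg)
    (hE : ∀ a ∈ H.endAlg, ∃ q : Fin 4 → ℚ, a = ∑ k, q k • φ ^ (k : ℕ))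
    (hdiv : ∀ a ∈ H.endAlg, a ≠ 0 → ∃ b : Module.End ℚ V, b * a = 1) {μ₁ μ₂ : ℂ}
    (h11 : starRingEnd ℂ μ₁ ≠ μ₁) (h22 : starRingEnd ℂ μ₂ ≠ μ₂) (h12 : μ₂ ≠ μ₁)
    (h12' : μ₂ ≠ starRingEnd ℂ μ₁) (hV : Module.finrank ℚ V = 8)
    (h1a : Module.finrank ℂ ↥(Module.End.eigenspace (φ.baseChange ℂ) μ₁ ⊓ H.piece 1 0) = 1)
    (h1b : Module.finrank ℂ ↥(Module.End.eigenspace (φ.baseChange ℂ) μ₁ ⊓ H.piece 0 1) = 1)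
    (h2a : Module.finrank ℂ ↥(Module.End.eigenspace (φ.baseChange ℂ) μ₂ ⊓ H.piece 1 0) = 2)
    (𝔤 : Submodule ℚ (Module.End ℚ V)) (hbr : ∀ X ∈ 𝔤, ∀ X' ∈ 𝔤, X * X' - X' * X ∈ 𝔤)
    {Θ : Module.End ℂ (ℂ ⊗[ℚ] V)} (hΘ : ∀ p, ∀ x ∈ H.piece p (n - p), Θ x = ((2 * p - n : ℤ) : ℂ) • x)
    (hΘ𝔤 : Θ ∈ spanC 𝔤)
    (hcomm : ∀ X ∈ 𝔤, ∀ a : H.endAlg, X * (a : Module.End ℚ V) = (a : Module.End ℚ V) * X)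
    (hskew : ∀ X ∈ 𝔤, ∀ v w, ψ.form (X v) w + ψ.form v (X w) = 0)
    {Y : Module.End ℂ (ℂ ⊗[ℚ] V)} (hYφ : Y * φ.baseChange ℂ = φ.baseChange ℂ * Y)
    (hYskew : ∀ x y, ψ.form.baseChange ℂ (Y x) y + ψ.form.baseChange ℂ x (Y y) = 0) :
    Y ∈ spanC 𝔤 := by
  classical
  obtain ⟨hP, hQ, hΘ10, hΘ01, hΘΘ⟩ := UnitaryTheta.theta_facts H hn heff hΘ
  set F := φ.baseChange ℂ with hF
  set ψC := ψ.form.baseChange ℂ with hψC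
  -- `𝔤_ℂ ⊆ 𝔨_ℂ`
  have h𝔊φ : ∀ Z ∈ spanC 𝔤, Z * F = F * Z := fun Z hZ => UnitaryTheta.commute_of_mem_spanC H hφE hcomm hZ
  have h𝔊W : ∀ Z ∈ spanC 𝔤, ∀ c, ∀ s ∈ Module.End.eigenspace F c, Z s ∈ Module.End.eigenspace F c :=
    fun Z hZ c s hs => UnitaryTheta.apply_mem_eigenspace_of_commute (h𝔊φ Z hZ) hs
  have h𝔊skew : ∀ Z ∈ spanC 𝔤, ∀ x y, ψC (Z x) y + ψC x (Z y) = 0 := fun Z hZ =>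
    ThetaSubalgebra.formBaseChange_add_eq_zero_of_mem_spanC ψ hskew hZ
  have h𝔊br : ∀ Z ∈ spanC 𝔤, ∀ Z' ∈ spanC 𝔤, Z * Z' - Z' * Z ∈ spanC 𝔤 := fun Z hZ Z' hZ' =>
    commutator_mem_spanC hbr hZ hZ'
  have hΘφ : Θ * F = F * Θ := h𝔊φ Θ hΘ𝔤
  have hXW : ∀ X ∈ 𝔤, ∀ c, ∀ w ∈ Module.End.eigenspace F c, X.baseChange ℂ w ∈ Module.End.eigenspace F c :=
    fun X hX c w hw => h𝔊W _ (baseChange_mem_spanC hX) c w hw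
  -- structure of the eigenspace decomposition
  obtain ⟨hW₂10, hf2, htop, hc1, hc2⟩ :=
    QuarticTheta.eigenspace_facts H hn heff hΘ hΘφ h11 h22 h12 h12' hV h1a h1b h2a
  subst hn
  set W₁ := Module.End.eigenspace F μ₁ with hW₁
  set W₂ := Module.End.eigenspace F μ₂ with hW₂
  -- the lines `W₁ ∩ V^{1,0} = ℂ e`, `W₁ ∩ V^{0,1} = ℂ ℓ`
  haveI : Nontrivial ↥(W₁ ⊓ H.piece 1 0) := Module.nontrivial_of_finrank_pos (R := ℂ) (by rw [h1a]; exact one_pos)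
  obtain ⟨⟨e, heL⟩, he0'⟩ := exists_ne (0 : ↥(W₁ ⊓ H.piece 1 0))
  have he0 : e ≠ 0 := fun h => he0' (Subtype.ext h)
  have hLe : ∀ s ∈ W₁ ⊓ H.piece 1 0, ∃ a : ℂ, s = a • e := fun s hs => by
    obtain ⟨a, ha⟩ := (finrank_eq_one_iff_of_nonzero' (⟨e, heL⟩ : ↥(W₁ ⊓ H.piece 1 0)) he0').1 h1a ⟨s, hs⟩
    exact ⟨a, by simpa using congrArg Subtype.val ha.symm⟩
  haveI : Nontrivial ↥(W₁ ⊓ H.piece 0 1) := Module.nontrivial_of_finrank_pos (R := ℂ) (by rw [h1b]; exact one_pos)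
  obtain ⟨⟨ℓ, hℓL⟩, hℓ0'⟩ := exists_ne (0 : ↥(W₁ ⊓ H.piece 0 1))
  have hℓ0 : ℓ ≠ 0 := fun h => hℓ0' (Subtype.ext h)
  have hL : ∀ s ∈ W₁ ⊓ H.piece 0 1, ∃ a : ℂ, s = a • ℓ := fun s hs => by
    obtain ⟨a, ha⟩ := (finrank_eq_one_iff_of_nonzero' (⟨ℓ, hℓL⟩ : ↥(W₁ ⊓ H.piece 0 1)) hℓ0').1 h1b ⟨s, hs⟩
    exact ⟨a, by simpa using congrArg Subtype.val ha.symm⟩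
  have hΘe : Θ e = e := hΘ10 e heL.2
  have hΘℓ : Θ ℓ = -ℓ := hΘ01 ℓ hℓL.2
  have hW₁dec : ∀ w ∈ W₁, ∃ a b : ℂ, w = a • e + b • ℓ := by
    intro w hw
    obtain ⟨a, ha⟩ := hLe _ ⟨Submodule.smul_mem _ _ (Submodule.add_mem _ hw (h𝔊W Θ hΘ𝔤 μ₁ w hw)), hP w⟩
    obtain ⟨b, hb⟩ := hL _ ⟨Submodule.smul_mem _ _ (Submodule.sub_mem _ hw (h𝔊W Θ hΘ𝔤 μ₁ w hw)), hQ w⟩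
    exact ⟨a, b, by rw [← ha, ← hb]; module⟩
  -- `W₁ ≠ 0`, `W₂ ≠ 0`
  have hne1 : W₁ ≠ ⊥ := fun h => he0 ((Submodule.mem_bot ℂ).1 (h ▸ heL.1))
  haveI : Nontrivial ↥(W₂ ⊓ H.piece 1 0) := Module.nontrivial_of_finrank_pos (R := ℂ) (by rw [h2a]; exact two_pos)
  obtain ⟨⟨w₂, hw₂⟩, hw₂0'⟩ := exists_ne (0 : ↥(W₂ ⊓ H.piece 1 0))
  have hw₂0 : w₂ ≠ 0 := fun h => hw₂0' (Subtype.ext h)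
  have hne2 : W₂ ≠ ⊥ := fun h => hw₂0 ((Submodule.mem_bot ℂ).1 (h ▸ hw₂.1))
  -- determination by `W₁ ⊕ W₂`
  have hdet : ∀ D : Module.End ℂ (ℂ ⊗[ℚ] V), D * F = F * D → (∀ x y, ψC (D x) y + ψC x (D y) = 0) →
      (∀ w ∈ W₁, D w = 0) → (∀ w ∈ W₂, D w = 0) → D = 0 := fun D hDφ hDskew hD1 hD2 =>
    QuarticTheta.eq_zero_of_forall_eigenspace H rfl heff ψ hφE hE hΘ hΘφ h11 h22 h12 h12' hne1 hne2 htop hDφ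
      hDskew hD1 hD2
  -- irreducibility of `W₁` and `W₂`
  have hRstab : ∀ (a b c : ℂ), ∀ X ∈ 𝔤, ∀ r ∈ Module.End.eigenspace F a ⊔ Module.End.eigenspace F b ⊔
      Module.End.eigenspace F c, X.baseChange ℂ r ∈ Module.End.eigenspace F a ⊔ Module.End.eigenspace F b ⊔
        Module.End.eigenspace F c := by
    intro a b c X hX r hr
    obtain ⟨u, hu, r₃, hr₃, rfl⟩ := Submodule.mem_sup.1 hr
    obtain ⟨r₁, hr₁, r₂, hr₂, rfl⟩ := Submodule.mem_sup.1 hu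
    rw [map_add, map_add]
    exact Submodule.add_mem_sup (Submodule.add_mem_sup (hXW X hX _ r₁ hr₁) (hXW X hX _ r₂ hr₂))
      (hXW X hX _ r₃ hr₃)
  have hirr1 : ∀ U : Submodule ℂ (ℂ ⊗[ℚ] V), U ≤ W₁ → (∀ Z ∈ spanC 𝔤, ∀ u ∈ U, Z u ∈ U) →
      U = ⊥ ∨ U = W₁ := fun U hUW hU =>
    QuarticTheta.eq_bot_or_eq_of_stable H rfl heff ψ hφE hE 𝔤 hΘ hΘ𝔤 hcomm hskew (hRstab _ _ _) hc1 hUW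
      fun X hX u hu => hU _ (baseChange_mem_spanC hX) u hu
  have hirr2 : ∀ U : Submodule ℂ (ℂ ⊗[ℚ] V), U ≤ W₂ → (∀ X ∈ 𝔤, ∀ u ∈ U, X.baseChange ℂ u ∈ U) →
      U = ⊥ ∨ U = W₂ := fun U hUW hU =>
    QuarticTheta.eq_bot_or_eq_of_stable H rfl heff ψ hφE hE 𝔤 hΘ hΘ𝔤 hcomm hskew (hRstab _ _ _) hc2 hUW hU
  -- the raising operator `E₊ : ℓ ↦ e` (zero on `V^{1,0}`)
  obtain ⟨Ep, hEp𝔊, hEpℓ, hEp0, -⟩ := UnitaryTheta.exists_raising (M := ℂ ⊗[ℚ] V) (𝔊 := spanC 𝔤) h𝔊br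
    hΘ𝔤 hΘΘ (S := W₁) (fun Z hZ s hs => h𝔊W Z hZ μ₁ s hs) hirr1 hℓL.1 hℓ0 hΘℓ
    (fun s hs => by
      obtain ⟨a, ha⟩ := hL _ ⟨Submodule.smul_mem _ _ (Submodule.sub_mem _ hs (h𝔊W Θ hΘ𝔤 μ₁ s hs)), hQ s⟩
      exact ⟨a, ha⟩)
    heL.1 hΘe
  -- the lowering operator `E₋ : e ↦ ℓ` (zero on `V^{0,1}`, values in `V^{0,1}`), from `T = -Θ`
  obtain ⟨Em, hEm𝔊, hEme, hEm0, hEmv⟩ := UnitaryTheta.exists_raising (M := ℂ ⊗[ℚ] V) (𝔊 := spanC 𝔤) h𝔊br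
    (T := -Θ) (Submodule.neg_mem _ hΘ𝔤)
    (fun v => by rw [LinearMap.neg_apply, LinearMap.neg_apply, map_neg, neg_neg, hΘΘ]) (S := W₁)
    (fun Z hZ s hs => h𝔊W Z hZ μ₁ s hs) hirr1 heL.1 he0 (by rw [LinearMap.neg_apply, hΘe])
    (fun s hs => by
      obtain ⟨a, ha⟩ := hLe _ ⟨Submodule.smul_mem _ _ (Submodule.add_mem _ hs (h𝔊W Θ hΘ𝔤 μ₁ s hs)), hP s⟩
      refine ⟨a, ?_⟩
      rw [LinearMap.neg_apply, sub_neg_eq_add, ha])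
    hℓL.1 (by rw [LinearMap.neg_apply, hΘℓ, neg_neg])
  have hEp10 : ∀ x ∈ H.piece 1 0, Ep x = 0 := fun x hx => hEp0 x (hΘ10 x hx)
  have hEm01 : ∀ x ∈ H.piece 0 1, Em x = 0 := fun x hx =>
    hEm0 x (by rw [LinearMap.neg_apply, hΘ01 x hx, neg_neg])
  have hEpe : Ep e = 0 := hEp10 e heL.2
  have hEmℓ : Em ℓ = 0 := hEm01 ℓ hℓL.2
  have hEpW₂ : ∀ w ∈ W₂, Ep w = 0 := fun w hw => hEp10 w (hW₂10 hw)
  have hEmW₂ : ∀ w ∈ W₂, Em w = 0 := by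
    intro w hw
    have h1 : Θ (Em w) = Em w := hΘ10 _ (hW₂10 (h𝔊W Em hEm𝔊 μ₂ w hw))
    have h2 : Θ (Em w) = -Em w := by
      have h := hEmv w
      rw [LinearMap.neg_apply, neg_eq_iff_eq_neg] at h
      exact h
    rw [h1] at h2
    have h3 : (2 : ℂ) • Em w = 0 := by rw [two_smul]; nth_rewrite 2 [h2]; rw [add_neg_cancel]
    exact (smul_eq_zero.1 h3).resolve_left two_ne_zero
  -- `H₁ = [E₊, E₋]`: `e ↦ e`, `ℓ ↦ -ℓ`, zero on `W₂`
  set H₁ := Ep * Em - Em * Ep with hH₁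
  have hH₁𝔊 : H₁ ∈ spanC 𝔤 := h𝔊br _ hEp𝔊 _ hEm𝔊
  have hH₁e : H₁ e = e := by
    rw [hH₁, LinearMap.sub_apply, Module.End.mul_apply, Module.End.mul_apply, hEme, hEpℓ, hEpe, map_zero,
      sub_zero]
  have hH₁ℓ : H₁ ℓ = -ℓ := by
    rw [hH₁, LinearMap.sub_apply, Module.End.mul_apply, Module.End.mul_apply, hEmℓ, map_zero, hEpℓ, hEme,
      zero_sub]
  have hH₁W₂ : ∀ w ∈ W₂, H₁ w = 0 := fun w hw => by
    rw [hH₁, LinearMap.sub_apply, Module.End.mul_apply, Module.End.mul_apply, hEmW₂ w hw, hEpW₂ w hw, map_zero,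
      map_zero, sub_zero]
  -- `ζ = Θ - H₁`: zero on `W₁`, the identity on `W₂`
  set ζ := Θ - H₁ with hζ
  have hζ𝔊 : ζ ∈ spanC 𝔤 := Submodule.sub_mem _ hΘ𝔤 hH₁𝔊
  have hζW₁ : ∀ w ∈ W₁, ζ w = 0 := by
    intro w hw
    obtain ⟨a, b, rfl⟩ := hW₁dec w hw
    rw [hζ, LinearMap.sub_apply, map_add, map_smul, map_smul, hΘe, hΘℓ, map_add, map_smul, map_smul, hH₁e,
      hH₁ℓ, sub_self]
  have hζW₂ : ∀ w ∈ W₂, ζ w = w := fun w hw => by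
    rw [hζ, LinearMap.sub_apply, hH₁W₂ w hw, sub_zero, hΘ10 w (hW₂10 hw)]
  -- `ζ` commutes with `𝔤`, hence lies in `E_ℂ`; a non-zero rational `t ∈ 𝔤 ∩ E`
  have hζcomm : ∀ X ∈ 𝔤, ζ * X.baseChange ℂ = X.baseChange ℂ * ζ := by
    intro X hX
    rw [← sub_eq_zero]
    have hmem : ζ * X.baseChange ℂ - X.baseChange ℂ * ζ ∈ spanC 𝔤 := h𝔊br _ hζ𝔊 _ (baseChange_mem_spanC hX)
    refine hdet _ (h𝔊φ _ hmem) (h𝔊skew _ hmem) (fun w hw => ?_) (fun w hw => ?_)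
    · rw [LinearMap.sub_apply, Module.End.mul_apply, Module.End.mul_apply, hζW₁ w hw, map_zero,
        hζW₁ _ (hXW X hX μ₁ w hw), sub_self]
    · rw [LinearMap.sub_apply, Module.End.mul_apply, Module.End.mul_apply, hζW₂ w hw,
        hζW₂ _ (hXW X hX μ₂ w hw), sub_self]
  have hζE := ThetaSubalgebra.mem_span_endAlg_of_forall_commute H 𝔤 hΘ hΘ𝔤 hζcomm
  have hζ0 : ζ ≠ 0 := fun h => hw₂0 (by rw [← hζW₂ w₂ hw₂.1, h, LinearMap.zero_apply])
  obtain ⟨t, ht𝔤, htE, ht0⟩ := QuarticTheta.exists_rat_of_mem_spanC_of_mem_span_endAlg H 𝔤 hζ𝔊 hζE hζ0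
  obtain ⟨s₁, hs₁⟩ := QuarticTheta.exists_smul_of_mem_endAlg H hE htE μ₁
  obtain ⟨s₂, hs₂⟩ := QuarticTheta.exists_smul_of_mem_endAlg H hE htE μ₂
  have hs₁0 : s₁ ≠ 0 := by
    intro hs0
    obtain ⟨b, hb⟩ := hdiv t htE ht0
    apply he0
    have h := hs₁ e heL.1
    rw [hs0, zero_smul] at h
    calc e = (b * t).baseChange ℂ e := by rw [hb, LinearMap.baseChange_one, Module.End.one_apply]
      _ = 0 := by rw [LinearMap.baseChange_mul, Module.End.mul_apply, h, map_zero]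
  -- `I₁ = s₁⁻¹ (t_ℂ - s₂ ζ)`: the identity on `W₁`, zero on `W₂`
  set I₁ := s₁⁻¹ • (t.baseChange ℂ - s₂ • ζ) with hI₁
  have hI₁𝔊 : I₁ ∈ spanC 𝔤 :=
    Submodule.smul_mem _ _ (Submodule.sub_mem _ (baseChange_mem_spanC ht𝔤) (Submodule.smul_mem _ _ hζ𝔊))
  have hI₁W₁ : ∀ w ∈ W₁, I₁ w = w := fun w hw => by
    rw [hI₁, LinearMap.smul_apply, LinearMap.sub_apply, LinearMap.smul_apply, hs₁ w hw, hζW₁ w hw, smul_zero,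
      sub_zero, smul_smul, inv_mul_cancel₀ hs₁0, one_smul]
  have hI₁W₂ : ∀ w ∈ W₂, I₁ w = 0 := fun w hw => by
    rw [hI₁, LinearMap.smul_apply, LinearMap.sub_apply, LinearMap.smul_apply, hs₂ w hw, hζW₂ w hw, sub_self,
      smul_zero]
  have hIe : I₁ e = e := hI₁W₁ e heL.1
  have hIℓ : I₁ ℓ = ℓ := hI₁W₁ ℓ hℓL.1
  -- (D) `𝔤𝔩(W₁) ⊆ 𝔤_ℂ|_{W₁ ⊕ W₂}`: matching a commuting operator on `W₁` by an element vanishing on `W₂`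
  have hD : ∀ Y' : Module.End ℂ (ℂ ⊗[ℚ] V), Y' * F = F * Y' →
      ∃ Z ∈ spanC 𝔤, (∀ w ∈ W₁, Z w = Y' w) ∧ (∀ w ∈ W₂, Z w = 0) := by
    intro Y' hY'φ
    have hY'W₁ : ∀ w ∈ W₁, Y' w ∈ W₁ := fun w hw => UnitaryTheta.apply_mem_eigenspace_of_commute hY'φ hw
    obtain ⟨α, β, hYe⟩ := hW₁dec _ (hY'W₁ e heL.1)
    obtain ⟨γ, δ, hYℓ⟩ := hW₁dec _ (hY'W₁ ℓ hℓL.1)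
    refine ⟨γ • Ep + β • Em + ((2 : ℂ)⁻¹ * (α - δ)) • H₁ + ((2 : ℂ)⁻¹ * (α + δ)) • I₁, ?_, ?_, ?_⟩
    · exact Submodule.add_mem _ (Submodule.add_mem _ (Submodule.add_mem _ (Submodule.smul_mem _ _ hEp𝔊)
        (Submodule.smul_mem _ _ hEm𝔊)) (Submodule.smul_mem _ _ hH₁𝔊)) (Submodule.smul_mem _ _ hI₁𝔊)
    · intro w hw
      obtain ⟨a, b, rfl⟩ := hW₁dec w hw
      simp only [LinearMap.add_apply, LinearMap.smul_apply, map_add, map_smul, hEpe, hEpℓ, hEme, hEmℓ, hH₁e,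
        hH₁ℓ, hIe, hIℓ, hYe, hYℓ, smul_zero, zero_add, add_zero]
      module
    · intro w hw
      simp only [LinearMap.add_apply, LinearMap.smul_apply, hEpW₂ w hw, hEmW₂ w hw, hH₁W₂ w hw, hI₁W₂ w hw,
        smul_zero, add_zero]
  -- (E) `𝔤𝔩(W₂) ⊆ 𝔤_ℂ|_{W₁ ⊕ W₂}`: the Lie algebra `𝔩` of restrictions to the plane `W₂` is irreducible and contains `1`
  let 𝔩 : Submodule ℂ (Module.End ℂ ↥W₂) :=
    { carrier := {T | ∃ Z ∈ spanC 𝔤, ∀ w : ↥W₂, ((T w : ↥W₂) : ℂ ⊗[ℚ] V) = Z w}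
      zero_mem' := ⟨0, Submodule.zero_mem _, fun w => by simp⟩
      add_mem' := by
        rintro T T' ⟨Z, hZ, hTZ⟩ ⟨Z', hZ', hTZ'⟩
        exact ⟨Z + Z', Submodule.add_mem _ hZ hZ', fun w => by
          rw [LinearMap.add_apply, Submodule.coe_add, hTZ, hTZ', LinearMap.add_apply]⟩
      smul_mem' := by
        rintro c T ⟨Z, hZ, hTZ⟩
        exact ⟨c • Z, Submodule.smul_mem _ _ hZ, fun w => by
          rw [LinearMap.smul_apply, Submodule.coe_smul, hTZ, LinearMap.smul_apply]⟩ }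
  have hmem𝔩 : ∀ T, T ∈ 𝔩 ↔ ∃ Z ∈ spanC 𝔤, ∀ w : ↥W₂, ((T w : ↥W₂) : ℂ ⊗[ℚ] V) = Z w := fun T => Iff.rfl
  have h𝔩br : ∀ T ∈ 𝔩, ∀ T' ∈ 𝔩, T * T' - T' * T ∈ 𝔩 := by
    intro T hT T' hT'
    obtain ⟨Z, hZ, hTZ⟩ := (hmem𝔩 T).1 hT
    obtain ⟨Z', hZ', hTZ'⟩ := (hmem𝔩 T').1 hT'
    refine (hmem𝔩 _).2 ⟨Z * Z' - Z' * Z, h𝔊br _ hZ _ hZ', fun w => ?_⟩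
    rw [LinearMap.sub_apply, Submodule.coe_sub, Module.End.mul_apply, Module.End.mul_apply, hTZ, hTZ', hTZ', hTZ,
      LinearMap.sub_apply, Module.End.mul_apply, Module.End.mul_apply]
  have h𝔩1 : (1 : Module.End ℂ ↥W₂) ∈ 𝔩 :=
    (hmem𝔩 _).2 ⟨ζ, hζ𝔊, fun w => by rw [Module.End.one_apply, hζW₂ w w.2]⟩
  have h𝔩irr : ∀ U : Submodule ℂ ↥W₂, (∀ T ∈ 𝔩, ∀ u ∈ U, T u ∈ U) → U = ⊥ ∨ U = ⊤ := by
    intro U hU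
    have hXres : ∀ X ∈ 𝔤, ∃ T ∈ 𝔩, ∀ w : ↥W₂, ((T w : ↥W₂) : ℂ ⊗[ℚ] V) = X.baseChange ℂ w :=
      fun X hX => ⟨(X.baseChange ℂ).restrict fun w hw => hXW X hX μ₂ w hw,
        (hmem𝔩 _).2 ⟨X.baseChange ℂ, baseChange_mem_spanC hX, fun w => rfl⟩, fun w => rfl⟩
    have h := hirr2 (U.map W₂.subtype) (Submodule.map_subtype_le W₂ U) (fun X hX u hu => by
      obtain ⟨u', hu', rfl⟩ := Submodule.mem_map.1 hu
      obtain ⟨T, hT, hTX⟩ := hXres X hX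
      rw [Submodule.subtype_apply, ← hTX u']
      exact Submodule.mem_map_of_mem (hU T hT u' hu'))
    rcases h with h | h
    · left
      exact Submodule.map_injective_of_injective W₂.injective_subtype (by rw [h, Submodule.map_bot])
    · right
      exact Submodule.map_injective_of_injective W₂.injective_subtype (by rw [h, Submodule.map_subtype_top])
  have h𝔩top : 𝔩 = ⊤ := QuarticTheta.eq_top_of_forall_stable hf2 𝔩 h𝔩br h𝔩1 h𝔩irr
  have hEx : ∀ Y' : Module.End ℂ (ℂ ⊗[ℚ] V), Y' * F = F * Y' →
      ∃ Z ∈ spanC 𝔤, (∀ w ∈ W₁, Z w = 0) ∧ (∀ w ∈ W₂, Z w = Y' w) := by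
    intro Y' hY'φ
    have hY'W₂ : ∀ w ∈ W₂, Y' w ∈ W₂ := fun w hw => UnitaryTheta.apply_mem_eigenspace_of_commute hY'φ hw
    have hT : Y'.restrict hY'W₂ ∈ 𝔩 := by rw [h𝔩top]; exact Submodule.mem_top
    obtain ⟨Z, hZ, hZY⟩ := (hmem𝔩 _).1 hT
    obtain ⟨Z₁, hZ₁, hZ₁W₁, hZ₁W₂⟩ := hD Z (h𝔊φ Z hZ)
    refine ⟨Z - Z₁, Submodule.sub_mem _ hZ hZ₁, fun w hw => ?_, fun w hw => ?_⟩
    · rw [LinearMap.sub_apply, hZ₁W₁ w hw, sub_self]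
    · have h := hZY ⟨w, hw⟩
      rw [LinearMap.coe_restrict_apply] at h
      rw [LinearMap.sub_apply, hZ₁W₂ w hw, sub_zero]
      exact h.symm
  -- assembly, and `Y = Z₁ + Z₂` by determination
  obtain ⟨Z₁, hZ₁, hZ₁W₁, hZ₁W₂⟩ := hD Y hYφ
  obtain ⟨Z₂, hZ₂, hZ₂W₁, hZ₂W₂⟩ := hEx Y hYφ
  have hD0 := hdet (Z₁ + Z₂ - Y)
    (by rw [sub_mul, mul_sub, add_mul, mul_add, h𝔊φ Z₁ hZ₁, h𝔊φ Z₂ hZ₂, hYφ])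
    (fun x y => by
      have h3 := h𝔊skew _ (Submodule.add_mem _ hZ₁ hZ₂) x y
      have h4 := hYskew x y
      rw [LinearMap.sub_apply, LinearMap.sub_apply, map_sub, LinearMap.sub_apply, map_sub]
      linear_combination h3 - h4)
    (fun w hw => by rw [LinearMap.sub_apply, LinearMap.add_apply, hZ₁W₁ w hw, hZ₂W₁ w hw, add_zero, sub_self])
    (fun w hw => by rw [LinearMap.sub_apply, LinearMap.add_apply, hZ₁W₂ w hw, hZ₂W₂ w hw, zero_add, sub_self])
  rw [sub_eq_zero] at hD0
  exact hD0 ▸ Submodule.add_mem _ hZ₁ hZ₂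

/-- **`𝔤_ℂ = 𝔲_E(V, ψ)_ℂ` as an equivalence**: `Y ∈ 𝔤_ℂ` iff `Y` commutes with `φ_ℂ` and is `ψ_ℂ`-skew.
[cite: MoonenZarhin1999LowDim, Thm. (0.2)(4) and §2 (2.4)] -/
theorem QuarticTheta.mem_spanC_iff_commute_and_skew [Module.Finite ℚ V] (H : HodgeStructure V n) (hn : n = 1)
    (heff : H.IsEffective) (ψ : H.Polarization) {φ : Module.End ℚ V} (hφE : φ ∈ H.endAlg)
    (hE : ∀ a ∈ H.endAlg, ∃ q : Fin 4 → ℚ, a = ∑ k, q k • φ ^ (k : ℕ))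
    (hdiv : ∀ a ∈ H.endAlg, a ≠ 0 → ∃ b : Module.End ℚ V, b * a = 1) {μ₁ μ₂ : ℂ}
    (h11 : starRingEnd ℂ μ₁ ≠ μ₁) (h22 : starRingEnd ℂ μ₂ ≠ μ₂) (h12 : μ₂ ≠ μ₁)
    (h12' : μ₂ ≠ starRingEnd ℂ μ₁) (hV : Module.finrank ℚ V = 8)
    (h1a : Module.finrank ℂ ↥(Module.End.eigenspace (φ.baseChange ℂ) μ₁ ⊓ H.piece 1 0) = 1)
    (h1b : Module.finrank ℂ ↥(Module.End.eigenspace (φ.baseChange ℂ) μ₁ ⊓ H.piece 0 1) = 1)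
    (h2a : Module.finrank ℂ ↥(Module.End.eigenspace (φ.baseChange ℂ) μ₂ ⊓ H.piece 1 0) = 2)
    (𝔤 : Submodule ℚ (Module.End ℚ V)) (hbr : ∀ X ∈ 𝔤, ∀ X' ∈ 𝔤, X * X' - X' * X ∈ 𝔤)
    {Θ : Module.End ℂ (ℂ ⊗[ℚ] V)} (hΘ : ∀ p, ∀ x ∈ H.piece p (n - p), Θ x = ((2 * p - n : ℤ) : ℂ) • x)
    (hΘ𝔤 : Θ ∈ spanC 𝔤)
    (hcomm : ∀ X ∈ 𝔤, ∀ a : H.endAlg, X * (a : Module.End ℚ V) = (a : Module.End ℚ V) * X)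
    (hskew : ∀ X ∈ 𝔤, ∀ v w, ψ.form (X v) w + ψ.form v (X w) = 0) (Y : Module.End ℂ (ℂ ⊗[ℚ] V)) :
    Y ∈ spanC 𝔤 ↔ Y * φ.baseChange ℂ = φ.baseChange ℂ * Y ∧
      ∀ x y, ψ.form.baseChange ℂ (Y x) y + ψ.form.baseChange ℂ x (Y y) = 0 :=
  ⟨fun hY => ⟨UnitaryTheta.commute_of_mem_spanC H hφE hcomm hY,
    ThetaSubalgebra.formBaseChange_add_eq_zero_of_mem_spanC ψ hskew hY⟩,
   fun h => QuarticTheta.mem_spanC_of_commute_of_skew H hn heff ψ hφE hE hdiv h11 h22 h12 h12' hV h1a h1b h2a 𝔤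
    hbr hΘ hΘ𝔤 hcomm hskew h.1 h.2⟩

/-- **`𝔤 = 𝔲_E(V, ψ)` over `ℚ`** (descent `X ∈ 𝔤 ↔ X_ℂ ∈ 𝔤_ℂ`): a rational operator lies in `𝔤` iff it commutes
with `φ` and is `ψ`-skew. In particular `𝔲_E(V, ψ)` is the ONLY rational Lie subalgebra of itself (commuting with
`E`) whose complexification contains `Θ` (Deligne's minimality principle, LNM 900 I Prop. 3.4, for this class).
[cite: MoonenZarhin1999LowDim, Thm. (0.2)(4) and §2 (2.4)] [cite: Deligne1982HodgeCycles, I §3 Prop. 3.4] -/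
theorem QuarticTheta.mem_iff_commute_and_skew [Module.Finite ℚ V] (H : HodgeStructure V n) (hn : n = 1)
    (heff : H.IsEffective) (ψ : H.Polarization) {φ : Module.End ℚ V} (hφE : φ ∈ H.endAlg)
    (hE : ∀ a ∈ H.endAlg, ∃ q : Fin 4 → ℚ, a = ∑ k, q k • φ ^ (k : ℕ))
    (hdiv : ∀ a ∈ H.endAlg, a ≠ 0 → ∃ b : Module.End ℚ V, b * a = 1) {μ₁ μ₂ : ℂ}
    (h11 : starRingEnd ℂ μ₁ ≠ μ₁) (h22 : starRingEnd ℂ μ₂ ≠ μ₂) (h12 : μ₂ ≠ μ₁)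
    (h12' : μ₂ ≠ starRingEnd ℂ μ₁) (hV : Module.finrank ℚ V = 8)
    (h1a : Module.finrank ℂ ↥(Module.End.eigenspace (φ.baseChange ℂ) μ₁ ⊓ H.piece 1 0) = 1)
    (h1b : Module.finrank ℂ ↥(Module.End.eigenspace (φ.baseChange ℂ) μ₁ ⊓ H.piece 0 1) = 1)
    (h2a : Module.finrank ℂ ↥(Module.End.eigenspace (φ.baseChange ℂ) μ₂ ⊓ H.piece 1 0) = 2)
    (𝔤 : Submodule ℚ (Module.End ℚ V)) (hbr : ∀ X ∈ 𝔤, ∀ X' ∈ 𝔤, X * X' - X' * X ∈ 𝔤)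
    {Θ : Module.End ℂ (ℂ ⊗[ℚ] V)} (hΘ : ∀ p, ∀ x ∈ H.piece p (n - p), Θ x = ((2 * p - n : ℤ) : ℂ) • x)
    (hΘ𝔤 : Θ ∈ spanC 𝔤)
    (hcomm : ∀ X ∈ 𝔤, ∀ a : H.endAlg, X * (a : Module.End ℚ V) = (a : Module.End ℚ V) * X)
    (hskew : ∀ X ∈ 𝔤, ∀ v w, ψ.form (X v) w + ψ.form v (X w) = 0) (X : Module.End ℚ V) :
    X ∈ 𝔤 ↔ X * φ = φ * X ∧ ∀ v w, ψ.form (X v) w + ψ.form v (X w) = 0 := by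
  refine ⟨fun hX => ⟨hcomm X hX ⟨φ, hφE⟩, hskew X hX⟩, fun h => ?_⟩
  rw [mem_iff_baseChange_mem_spanC 𝔤 X]
  exact QuarticTheta.mem_spanC_of_commute_of_skew H hn heff ψ hφE hE hdiv h11 h22 h12 h12' hV h1a h1b h2a 𝔤 hbr
    hΘ hΘ𝔤 hcomm hskew (by rw [← LinearMap.baseChange_mul, h.1, LinearMap.baseChange_mul])
    (ThetaSubalgebra.formBaseChange_add_eq_zero_of_skew ψ h.2)

/-- **`Lie Hg(H) = 𝔲_E(V, ψ)`** (Moonen–Zarhin 1999 Thm. (0.2)(4) for simple Type IV(2,1) outside case (b):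
"`Hg(X) = Sp_D(V,φ)`", the centralizer of `D = E` in `Sp(V,φ)`, i.e. the unitary group of the `E`-hermitian form),
infinitesimally, for multiplicities `{(1,1),(2,0)}`: `X ∈ Lie Hg(H)` iff `X` commutes with `φ` and is `ψ`-skew.
`Lie Hg(H)` is such a `𝔤`: bracket-closed (`commutator_mem_hodgeLie`), `Θ ∈ Lie Hg ⊗ ℂ`
(`mem_hodgeLieC_of_forall_piece`), commuting with `End_Hdg` and `ψ`-skew (`[HodgeTensorFacts]`).
[cite: MoonenZarhin1999LowDim, Thm. (0.2)(4) and §2 (2.4)] [cite: MoonenZarhin1995Duke, Thm. (0.2) for simple fourfolds (via MZ99 (2.4))]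
[cite: Huybrechts2016K3, Thm. 3.3.9 (proof, p. 67)] -/
theorem QuarticTheta.mem_hodgeLie_iff_commute_and_skew [Module.Finite ℚ V] [HodgeTensorFacts.{u, u}]
    (H : HodgeStructure V n) (hn : n = 1) (heff : H.IsEffective) (ψ : H.Polarization) {φ : Module.End ℚ V}
    (hφE : φ ∈ H.endAlg) (hE : ∀ a ∈ H.endAlg, ∃ q : Fin 4 → ℚ, a = ∑ k, q k • φ ^ (k : ℕ))
    (hdiv : ∀ a ∈ H.endAlg, a ≠ 0 → ∃ b : Module.End ℚ V, b * a = 1) {μ₁ μ₂ : ℂ}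
    (h11 : starRingEnd ℂ μ₁ ≠ μ₁) (h22 : starRingEnd ℂ μ₂ ≠ μ₂) (h12 : μ₂ ≠ μ₁)
    (h12' : μ₂ ≠ starRingEnd ℂ μ₁) (hV : Module.finrank ℚ V = 8)
    (h1a : Module.finrank ℂ ↥(Module.End.eigenspace (φ.baseChange ℂ) μ₁ ⊓ H.piece 1 0) = 1)
    (h1b : Module.finrank ℂ ↥(Module.End.eigenspace (φ.baseChange ℂ) μ₁ ⊓ H.piece 0 1) = 1)
    (h2a : Module.finrank ℂ ↥(Module.End.eigenspace (φ.baseChange ℂ) μ₂ ⊓ H.piece 1 0) = 2)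
    (X : Module.End ℚ V) :
    X ∈ H.hodgeLie ↔ X * φ = φ * X ∧ ∀ v w, ψ.form (X v) w + ψ.form v (X w) = 0 := by
  obtain ⟨Θ, hΘ⟩ := exists_hodgeTheta H
  have hΘ𝔤 : Θ ∈ spanC H.hodgeLie := (hodgeLieC_eq_spanC H) ▸ H.mem_hodgeLieC_of_forall_piece hΘ
  exact QuarticTheta.mem_iff_commute_and_skew H hn heff ψ hφE hE hdiv h11 h22 h12 h12' hV h1a h1b h2a H.hodgeLie
    (fun X hX Y hY => H.commutator_mem_hodgeLie hX hY) hΘ hΘ𝔤 (fun X hX a => H.commute_of_mem_hodgeLie hX a)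
    (fun X hX => form_apply_add_eq_zero_of_mem_hodgeLie ψ hX) X

/-- **`𝔤 = Lie Hg(H)`: `Lie Hg(H)` is the only rational Lie subalgebra of `𝔲_E(V, ψ)` commuting with `E` whose
complexification contains `Θ`** (Deligne's minimality, LNM 900 I Prop. 3.4, in Lie form for quartic CM type
`{(1,1),(2,0)}`). [cite: Deligne1982HodgeCycles, I §3 Prop. 3.4] [cite: MoonenZarhin1999LowDim, Thm. (0.2)(4)] -/
theorem QuarticTheta.eq_hodgeLie [Module.Finite ℚ V] [HodgeTensorFacts.{u, u}] (H : HodgeStructure V n)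
    (hn : n = 1) (heff : H.IsEffective) (ψ : H.Polarization) {φ : Module.End ℚ V} (hφE : φ ∈ H.endAlg)
    (hE : ∀ a ∈ H.endAlg, ∃ q : Fin 4 → ℚ, a = ∑ k, q k • φ ^ (k : ℕ))
    (hdiv : ∀ a ∈ H.endAlg, a ≠ 0 → ∃ b : Module.End ℚ V, b * a = 1) {μ₁ μ₂ : ℂ}
    (h11 : starRingEnd ℂ μ₁ ≠ μ₁) (h22 : starRingEnd ℂ μ₂ ≠ μ₂) (h12 : μ₂ ≠ μ₁)
    (h12' : μ₂ ≠ starRingEnd ℂ μ₁) (hV : Module.finrank ℚ V = 8)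
    (h1a : Module.finrank ℂ ↥(Module.End.eigenspace (φ.baseChange ℂ) μ₁ ⊓ H.piece 1 0) = 1)
    (h1b : Module.finrank ℂ ↥(Module.End.eigenspace (φ.baseChange ℂ) μ₁ ⊓ H.piece 0 1) = 1)
    (h2a : Module.finrank ℂ ↥(Module.End.eigenspace (φ.baseChange ℂ) μ₂ ⊓ H.piece 1 0) = 2)
    (𝔤 : Submodule ℚ (Module.End ℚ V)) (hbr : ∀ X ∈ 𝔤, ∀ X' ∈ 𝔤, X * X' - X' * X ∈ 𝔤)
    {Θ : Module.End ℂ (ℂ ⊗[ℚ] V)} (hΘ : ∀ p, ∀ x ∈ H.piece p (n - p), Θ x = ((2 * p - n : ℤ) : ℂ) • x)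
    (hΘ𝔤 : Θ ∈ spanC 𝔤)
    (hcomm : ∀ X ∈ 𝔤, ∀ a : H.endAlg, X * (a : Module.End ℚ V) = (a : Module.End ℚ V) * X)
    (hskew : ∀ X ∈ 𝔤, ∀ v w, ψ.form (X v) w + ψ.form v (X w) = 0) : 𝔤 = H.hodgeLie := by
  ext X
  rw [QuarticTheta.mem_iff_commute_and_skew H hn heff ψ hφE hE hdiv h11 h22 h12 h12' hV h1a h1b h2a 𝔤 hbr hΘ hΘ𝔤
    hcomm hskew, QuarticTheta.mem_hodgeLie_iff_commute_and_skew H hn heff ψ hφE hE hdiv h11 h22 h12 h12' hV h1a h1b h2a]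

end Main

/-! ### §5 Theorem L″: rational tensors killed by `Θ` are killed by `𝔲_E(V, ψ)_ℂ ≅ 𝔤𝔩(W_{μ₁}) × 𝔤𝔩(W_{μ₂})` -/

section AnnLie

open Literature.RepresentationTheory.GeneralLinear Literature.NumberTheory.DiophantineGeometry

universe u

variable {V : Type u} [AddCommGroup V] [Module ℚ V] {n : ℤ} {M N k : ℕ}

/-- **Theorem L″ (invariance of rational tensors under `𝔲_E(V, ψ)_ℂ`; Lie step of `B(Xⁿ) = D(Xⁿ)` for simple
Type IV(2,1) of signature `{(1,1),(2,0)}`).** In the setting of `QuarticTheta.mem_spanC_of_commute_of_skew`, let `q`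
be a rational coefficient tensor (letters: slots `Fin k` × a `ℚ`-basis `eQ` of `V`) killed — slice by slice,
diagonally — by the matrix of the Hodge operator `Θ`. Then `q` is killed by the matrix of EVERY `ψ_ℂ`-skew operator
`Y` of `V_ℂ` commuting with `φ_ℂ`. Proof: the rational Lie algebra `𝔞 ⊆ 𝔲_E(V, ψ)` of operators killing `q`
(`annLie`, with `E = End_Hdg(V)` as commuting family) is bracket-closed and `Θ ∈ 𝔞_ℂ` by descent
(`mem_spanC_annLie`, Deligne LNM 900 I §3), so `𝔞_ℂ = 𝔲_E(V,ψ)_ℂ ∋ Y` by the theorem. (MZ99 (0.2)(4): "`Hg(X) =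
Sp_D(V,φ)` and `B(Xⁿ) = D(Xⁿ)` for all `n`"; the passage to divisor classes is by the invariant theory of
`GL(W_{μ₁}) × GL(W_{μ₂})`, MZ99 §3 (3.1).) [cite: MoonenZarhin1999LowDim, Thm. (0.2)(4) and §3 (3.1)]
[cite: Deligne1982HodgeCycles, I §3 (proof of Prop. 3.4)] [cite: Gordon1997, §6 (pp. 18–19)] -/
theorem QuarticTheta.wordDerAt_eq_zero_of_commute_of_skew [Module.Finite ℚ V] [HodgeTensorFacts.{u, u}]
    (H : HodgeStructure V n) (hn : n = 1) (heff : H.IsEffective) (ψ : H.Polarization) {φ : Module.End ℚ V}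
    (hφE : φ ∈ H.endAlg) (hE : ∀ a ∈ H.endAlg, ∃ q : Fin 4 → ℚ, a = ∑ k, q k • φ ^ (k : ℕ))
    (hdiv : ∀ a ∈ H.endAlg, a ≠ 0 → ∃ b : Module.End ℚ V, b * a = 1) {μ₁ μ₂ : ℂ}
    (h11 : starRingEnd ℂ μ₁ ≠ μ₁) (h22 : starRingEnd ℂ μ₂ ≠ μ₂) (h12 : μ₂ ≠ μ₁)
    (h12' : μ₂ ≠ starRingEnd ℂ μ₁) (hV : Module.finrank ℚ V = 8)
    (h1a : Module.finrank ℂ ↥(Module.End.eigenspace (φ.baseChange ℂ) μ₁ ⊓ H.piece 1 0) = 1)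
    (h1b : Module.finrank ℂ ↥(Module.End.eigenspace (φ.baseChange ℂ) μ₁ ⊓ H.piece 0 1) = 1)
    (h2a : Module.finrank ℂ ↥(Module.End.eigenspace (φ.baseChange ℂ) μ₂ ⊓ H.piece 1 0) = 2)
    (eQ : Module.Basis (Fin M) ℚ V) (q : (Fin N → Fin k × Fin M) → ℚ) {Θ : Module.End ℂ (ℂ ⊗[ℚ] V)}
    (hΘ : ∀ p, ∀ x ∈ H.piece p (n - p), Θ x = ((2 * p - n : ℤ) : ℂ) • x)
    (hΘq : ∀ u : Fin N → Fin k, wordDerAt ℂ (fun _ : Fin N =>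
      LinearMap.toMatrix (Algebra.TensorProduct.basis ℂ eQ) (Algebra.TensorProduct.basis ℂ eQ) Θ)
      (wordSlice (fun w => algebraMap ℚ ℂ (q w)) u) = 0)
    {Y : Module.End ℂ (ℂ ⊗[ℚ] V)} (hYφ : Y * φ.baseChange ℂ = φ.baseChange ℂ * Y)
    (hYskew : ∀ x y, ψ.form.baseChange ℂ (Y x) y + ψ.form.baseChange ℂ x (Y y) = 0)
    (u : Fin N → Fin k) :
    wordDerAt ℂ (fun _ : Fin N =>
      LinearMap.toMatrix (Algebra.TensorProduct.basis ℂ eQ) (Algebra.TensorProduct.basis ℂ eQ) Y)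
      (wordSlice (fun w => algebraMap ℚ ℂ (q w)) u) = 0 := by
  -- the rational Lie algebra `𝔞 ⊆ 𝔲_E(V, ψ)` of `q`, with `E = End_Hdg(V)` itself as the commuting family
  set 𝔞 : Submodule ℚ (Module.End ℚ V) := annLie ψ.form eQ (fun a : H.endAlg => (a : Module.End ℚ V)) q
    with h𝔞
  have hΘC : Θ ∈ H.hodgeLieC := H.mem_hodgeLieC_of_forall_piece hΘ
  have hΘ𝔞 : Θ ∈ spanC 𝔞 :=
    mem_spanC_annLie ψ.form eQ _ q hΘq (fun a => commute_baseChange_of_mem_hodgeLieC H hΘC a)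
      fun x y => by rw [formBaseChange_skew_of_mem_hodgeLieC ψ hΘC, neg_add_cancel]
  have hbr : ∀ X ∈ 𝔞, ∀ X' ∈ 𝔞, X * X' - X' * X ∈ 𝔞 := fun X hX X' hX' =>
    commutator_mem_annLie ψ.form eQ _ q hX hX'
  have hcomm : ∀ X ∈ 𝔞, ∀ a : H.endAlg, X * (a : Module.End ℚ V) = (a : Module.End ℚ V) * X :=
    fun X hX a => ((mem_annLie_iff ψ.form eQ _ q X).1 hX).2.1 a
  have hskew : ∀ X ∈ 𝔞, ∀ v w, ψ.form (X v) w + ψ.form v (X w) = 0 :=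
    fun X hX => ((mem_annLie_iff ψ.form eQ _ q X).1 hX).2.2
  have hY : Y ∈ spanC 𝔞 :=
    QuarticTheta.mem_spanC_of_commute_of_skew H hn heff ψ hφE hE hdiv h11 h22 h12 h12' hV h1a h1b h2a 𝔞 hbr hΘ hΘ𝔞
      hcomm hskew hYφ hYskew
  rw [h𝔞] at hY
  exact wordDerAt_eq_zero_of_mem_spanC_annLie ψ.form eQ _ q hY u

end AnnLie

end HodgeStructure

end Literature.AlgebraicGeometry.Motives

end
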